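import Summits.QuantumFields.YangMills.Theorems.NPointIsotropy.Negative.TieLoadBearing
import Summits.QuantumFields.YangMills.Theorems.NPointIsotropy.Negative.DegreeTwoFree
import Summits.QuantumFields.YangMills.Theorems.NPointIsotropy.Negative.NPointRegularJunk
import Summits.QuantumFields.YangMills.Theorems.NPointIsotropy.Negative.AngularBandLimitFalse
import Summits.QuantumFields.YangMills.Theorems.CurvatureBoostCovariance.Negative.Unbundled
import Summits.QuantumFields.YangMills.Theorems.CurvatureBoostCovariance.Negative.BetaZeroTie
import Summits.QuantumFields.YangMills.Theorems.PencilRigidityNPointIsotropyBandlimit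
import Summits.QuantumFields.YangMills.Theorems.PencilRigidityNPointIsotropyMopup
import Summits.QuantumFields.YangMills.Theorems.PencilRigidityNPointIsotropyDegreeLeTwo
import Summits.QuantumFields.YangMills.Theorems.PencilRigidityNPointIsotropyRiemannSum
import Summits.QuantumFields.YangMills.Theorems.PencilRigidityNPointIsotropyLatticeOnePoint
import Summits.QuantumFields.YangMills.Theorems.PencilRigidityNPointIsotropyOnePoint
import Summits.QuantumFields.YangMills.Theorems.PencilRigidityNPointIsotropyDegreeOneTie
import Summits.QuantumFields.YangMills.Theorems.PencilRigidityNPointIsotropyOffDiagCutoff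
import Summits.QuantumFields.YangMills.Theorems.PencilRigidityNPointIsotropyOffDiagCutoffTendsto
import Summits.QuantumFields.YangMills.Theorems.PencilRigidityNPointIsotropyLocalOffDiagDensity
import Summits.QuantumFields.YangMills.Theorems.PencilRigidityNPointIsotropyOffDiagDensity
import Summits.QuantumFields.YangMills.Theorems.PencilRigidityNPointIsotropyBetaZeroSlice
import Summits.QuantumFields.YangMills.Theorems.MirrorModularBoostsPlanarSpectralCone
import Summits.QuantumFields.YangMills.Theorems.MirrorModularBoostsCurvatureBoostCovarianceTensorDensity
import Summits.QuantumFields.YangMills.Theorems.MirrorModularBoostsCurvatureBoostCovarianceDoubledToInvariant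
import Summits.QuantumFields.YangMills.Theorems.MirrorModularBoostsCurvatureBoostCovarianceRayPositivityCore
import Summits.QuantumFields.YangMills.Theorems.MirrorModularBoostsCurvatureBoostCovarianceRayPositivity
import Summits.QuantumFields.YangMills.Theorems.MirrorModularBoostsCurvatureBoostCovarianceOrbitGluing
import Summits.QuantumFields.YangMills.Theorems.MirrorModularBoostsCurvatureBoostCovarianceOrbitGenericUpgrade
import Summits.QuantumFields.YangMills.Theorems.MirrorModularBoostsCurvatureBoostCovarianceOrbitAllAngles
import Summits.QuantumFields.YangMills.Theorems.MirrorModularBoostsCurvatureBoostCovarianceOrbitLocalContinuation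
import Summits.QuantumFields.YangMills.Theorems.MirrorModularBoostsCurvatureBoostCovarianceOrbitBandlimit
import Summits.QuantumFields.YangMills.Theorems.MirrorModularBoostsCurvatureBoostCovarianceParitySieve
import Summits.QuantumFields.YangMills.Theorems.MirrorModularBoostsCurvatureBoostCovarianceGramVecOnStrip
import Summits.QuantumFields.YangMills.Theorems.MirrorModularBoostsCurvatureBoostCovarianceOperatorConeFamily
import Summits.QuantumFields.YangMills.Theorems.MirrorModularBoostsCurvatureBoostCovarianceLevelGrowthLow
import Summits.QuantumFields.YangMills.Theorems.PencilRigidityNPointIsotropyDoubledOrbitKernelDegOneAll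
import Summits.QuantumFields.YangMills.Theorems.MirrorModularBoostsCurvatureBoostCovarianceDominatedTieLimit
import Summits.QuantumFields.YangMills.Theorems.MirrorModularBoostsCurvatureBoostCovarianceRegularOfDominated
import Summits.QuantumFields.YangMills.Theorems.PencilRigidityNPointIsotropyLatticeOfContinuousRegular
import Summits.QuantumFields.YangMills.Theorems.PencilRigidityNPointIsotropyOrbitGapsPlanarTube
import Summits.QuantumFields.YangMills.Theorems.PencilRigidityNPointIsotropyTwoSlotEnvelopeObstruction
import Literature.MathematicalPhysics.QuantumFieldTheory.OSReconstructionNoE1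
import Literature.MathematicalPhysics.QuantumFieldTheory.SchwingerLimitInheritance
import HarnessLib
import Summits.QuantumFields.YangMills.Theorems.MirrorModularBoostsSoftKernelBoostCovarianceOfInputs
import Summits.QuantumFields.YangMills.Theorems.MirrorModularBoostsSoftKernelBoostCovariancePlanarInvariantOfInputs
import Summits.QuantumFields.YangMills.Theorems.MirrorModularBoostsSoftKernelBoostCovarianceStepZeroOfLattice
import Summits.QuantumFields.YangMills.Theorems.PencilRigidityNPointIsotropyOfSibling
import Summits.QuantumFields.YangMills.Theorems.PencilRigidityNPointIsotropyCoreCertificate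
import Summits.QuantumFields.YangMills.Theorems.PencilRigidityNPointIsotropyBetNecessary
import Summits.QuantumFields.YangMills.Theorems.CurvatureKernelBound.Negative.Handles
import Summits.QuantumFields.YangMills.Theorems.PencilRigidityNPointIsotropyPlanarInvariantOfInputsRadial
import Summits.QuantumFields.YangMills.Theorems.PencilRigidityNPointIsotropyStepZeroOfT
import Summits.QuantumFields.YangMills.Theorems.PencilRigidityNPointIsotropySandwichVacuumRowOfKernel
import Summits.QuantumFields.YangMills.Theorems.PencilRigidityNPointIsotropyOfRouteItems


/-!
# Line `complex-rotation-bandlimit` — LEAD's skeleton, GENERATION 12, for crux `PencilRigidity.NPointIsotropy`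
(stmt-QuantumFields-11686; continuation lead `prover-line-stmt-QuantumFields-11686-c6-0`; `Cruxes/NPointIsotropy/PICKED.md`)

## Status, generation 12b (2026-08-17T04Z, lead c6, cycle 2): wave 1 INTEGRATED — nothing model-blind is left

* LANDED since generation 12 was registered (02:36Z): `stub_planarInvariantOfInputsRadial` (p138998, with the radial certificates
  `nPointIsotropy_of_stepZero_sigmaRadial` / `nPointIsotropy_of_T_sigmaRadial`), `stub_stepZeroOfT` (p139269, with the items
  certificate `nPointIsotropy_of_items` and `sandwichBoundRadial_of_items`), the calibration helpers of `stub_sandwichVacuumRowOfKernel`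
  (`vacuumRow_double_lintegral_bound`, p140722) and the stub itself (p140939), and the BY-NAME certificate
  `Theorems/PencilRigidityNPointIsotropyOfRouteItems.lean`: `IsotropyFromPowerCounting.CurvatureDensities` (stmt-17723, Step 0)
  `→ IsotropyFromPowerCounting.CurvatureSandwichBound` (stmt-18372 — Σ RESTATED by the planner at 02:29Z with the `45°` frame named
  by coordinates; bridged by the landed `sandwichBound_planeRot_of_curvatureSandwichBound`) `→ PencilRigidity.CurvatureKernelBound`
  (stmt-11687) `→ PencilRigidity.NPointIsotropy`, and the same from `IsotropyFromPowerCounting.TemperedCurvatureMoments` (stmt-17721).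
* The two `sorry`s of the composition `NPointIsotropy_of` are now EXACTLY the two Yang–Mills UV inputs, each an item with its own
  seats: `stub_tieRegularity` (Step 0 = stmt-17723 `CurvatureDensities` byte-identical; RESHAPED in 12b from its sufficient condition
  T = stmt-17721, which stays recorded as the hypothesis of the landed `stub_stepZeroOfT`) and
  `stub_sandwichBoundRadial` (Σ asked of this crux's families ⟸ stmt-18372 ∧ stmt-11687, `sandwichBoundRadial_of_items` +
  the bridge).  There is no third `sorry`: the calibration `stub_sandwichVacuumRowOfKernel` is landed (p140939).
* What the radial kernel (the crux's one hypothesis beyond 14999's) buys is exhausted: levels `a ≤ 1` of the sieve.  It bounds no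
  UV dimension, so it cannot touch T or Σ (see "What the radial kernel buys" below).  This crux is therefore BLOCKED ON the items
  stmt-18372 (Σ) and stmt-17723/17721 (Step 0 / T) — plus stmt-11687, which PencilRigidity carries anyway.

## What generation 12 is (2026-08-17T03Z, lead c6): THE SANDWICH TRANSPLANT

Generation 11 (lead c5, text kept below) closed the crux modulo three inputs: Step 0 (`stub_temperedLatticeApproximants`, the
Yang–Mills UV input, shared with stmt-9663 / stmt-14999), the analytic input `stub_doubledOrbitKernelHigh` (OS II multi-slot tower
WITHOUT E1 along complex-rotation orbits; model-blind, XL, promoted by c5 but not an item) and the bet `stub_levelGrowthHigh`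
(level growth at levels `a ≥ 2`; no engine).  Meanwhile the sibling crux stmt-QuantumFields-14999
`MirrorModularBoosts.SoftKernelBoostCovariance` (line `Sketch`, idea `transverse-slack-heat-sandwich`, leads 14999-0…c4) LANDED a
complete model-blind OPERATOR CHAIN — cone family `stub_coneFamily` p100538, insertion operators p107219, Hilbert Vitali p107687,
radial-bump chains p113974/p134904, lower block p116767, bump-tensor approximation p117686/p134442, heights p134806, chains with
insertion operators p135335, term chains p135441, UNIFORM PLANAR BOOST VECTORS `stub_asmUniformBoost` p135459, TYPED boost vectors
`stub_asmTypedBoost` p135579, local band limit / ray positivity p102333/p102747, Laurent layers p96941, `stub_levelGrowthHigh_of_boostType`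
p97905, the compositions `stub_cruxOfInputs` p135724 / `stub_planarInvariantOfInputs` p136406, the glue `stub_stepZeroOfLattice` —
which REPLACES BOTH of those residuals by ONE Yang–Mills input, the transversely filtered heat-sandwich bound Σ
(`‖Ψ_{f₁ ⊗ W_{(2u+v)e₀}}‖ ≤ C·Mg·(Mh + Mh')·(u^{-μ} + v^{-μ})·‖Ψ_W‖` for one-point insertions `f₁ = g(x⁰,x¹) hh(x²,x³)` with times in
`[u, 2u]`, all time-ordered `W`, in the `e₀` frame and in the `45°` frame): from Σ with ANY exponent the chain BUILDS the uniform
planar boost vectors — so the OS tower is not needed (the multi-slot continuation is constructed slot by slot as an operator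
product, the sandwich bound paying for each insertion) — and from Σ with exponent `μ < 4`, at a level at which the lower degrees
are already planar-invariant, it builds boost vectors of TYPE `μ`, whose growth `Σ_k p_k e^{-4kχ} = ‖V(iχ)‖² ≤ C e^{2μ|χ|}`,
`2μ < 8`, kills the layers `|k| ≥ 2` of the diagonal doubled pencils outright — so the bet is not needed either: it is REPLACED by
a UV power-counting statement (one insertion of the dimension-4 density costs strictly less than `u⁻⁴`).  The 14999 composition
consumes its soft two-point kernel triple in exactly ONE place besides Σ's antecedent: level growth at levels `a ≤ 1`
(`levelGrowthLow_of_kernel_pointwise`: triple + `KernelTransfer` + `ShellRigidity_proof` ⇒ radial ⇒ degree-2 doubled orbits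
constant).  On THIS crux that step is free from the RADIAL kernel (`levelGrowthLow_of_radialKernel`, lead c2, landed p108731).

Hence generation 12 (this file):

* DROPPED from the skeleton (superseded; nothing landed is orphaned; the texts stay in generation 11b of this file's tree
  history, commit of 2026-08-17T02:06Z, and — still registered — on stmt-9663): `stub_doubledOrbitKernelHigh`,
  `stub_doubledOrbitKernel`, `stub_uniformPlanarBoostVectors`, `planarBoostVectors_of_uniform`, the global `sieve_of_stubs`,
  `planarInvariant_of_regular_of_growthHigh`, `stub_levelGrowthHigh`, `levelGrowthHighRadial_of_shared`.  (The landed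
  certificates about them stay true and imported: `nPointIsotropy_of_inputs` — Step 0 → doubled orbit kernel → radial bet →
  crux, `Theorems/PencilRigidityNPointIsotropyCoreCertificate.lean`; `levelGrowthHighRadial_of_nPointIsotropy` — the radial bet is
  NECESSARY, `…BetNecessary.lean`; and with generation 12 the radial bet becomes a COROLLARY of T ∧ Σ_radial.)
* NEW OPEN STUB `stub_sandwichBoundRadial` — Σ ASKED OF THIS CRUX'S FAMILIES (the Yang–Mills UV input that replaces the OS tower
  and the bet): for every compact simple `G`, `r`, `sch`, `S₁` with `W1 r sch S₁`, the eight frames and the RADIAL kernel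
  (verbatim the crux's hypotheses): (e₀) for every `e₀`-reconstruction a sandwich bound with SOME exponent `μ < 4`; (45°) for
  every `e₀`-reconstruction of the 45° pull-back a sandwich bound with SOME exponent — NO threshold there: the pull-back's boost
  vectors are only needed to EXIST (ray positivity on the half-line `s < 0` is a Gram statement of any type), which the 14999
  composition already exploits (`obtain ⟨μT₀, CμT, -, hST₀⟩`).  It is implied by the pair of EXISTING items
  Σ = stmt-QuantumFields-17720 (`IsotropyFromPowerCounting.CurvatureSandwichBound`, byte-identical with 14999's registered
  `stub_sandwichBound`: kernel-triple antecedent, `μ < 4` in both frames) and stmt-QuantumFields-11687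
  (`PencilRigidity.CurvatureKernelBound`, which supplies the triple under `W₁`): `sandwichBoundRadial_of_items` below, sorry-free.
* NEW REGISTERED PROVABLE STUBS (wave 1 of this seat): `stub_planarInvariantOfInputsRadial` — the POINTWISE model-blind
  composition for ONE family (OS package + translations + hypercubic + eight frames + cone + RADIAL kernel + `NPointRegular` +
  Σ_e₀(`μ < 4`) + Σ_45°(any) ⇒ `PlanarInvariant`; = 14999's landed `stub_planarInvariantOfInputs` with `levelGrowthLow_of_radialKernel`
  in place of `levelGrowthLow_of_kernel_pointwise`); `stub_stepZeroOfT` (T ⇒ Step 0 for all families; five lines over the landed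
  `stub_stepZeroOfLattice`; its file carries the by-name certificate over the three items); `stub_sandwichVacuumRowOfKernel`
  (CALIBRATION of Σ: its degree-0 row is a THEOREM under the kernel triple with `0 < η ≤ 2`, exponent `4 - η/2 < 4` — the
  transverse sup-norm buys `∫_{ℝ²} (4u² + |w|²)^{(η-10)/2} dw ≍ u^{η-8}`; confirms that `μ < 4 ⟺ η > 0` on the vacuum row, as the
  14999 card and Disproof §5 assert on paper).
* COMPOSITIONS (sorry-free modulo the named stubs): `NPointIsotropy_of` — THE CRUX BY NAME from `stub_temperedLatticeApproximants`
  (T = item stmt-QuantumFields-17721 `IsotropyFromPowerCounting.TemperedCurvatureMoments`, byte-identical) and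
  `stub_sandwichBoundRadial`, through `stub_tieRegularity` (landed glue) and `stub_planarInvariantOfInputsRadial`; `sandwichBoundRadial_of_items`
  (Σ_radial ⟸ 17720-text ∧ 11687, in this file); and — in the Theorems file of `stub_stepZeroOfT` (wave 1), because a second theorem
  concluding the crux may not live in the skeleton — the certificate `nPointIsotropy_of_items : T → Σ (17720 text) →
  PencilRigidity.CurvatureKernelBound → NPointIsotropy` over THREE EXISTING ITEMS (through 14999's landed `stub_cruxOfInputs` and this
  crux's landed `nPointIsotropy_of_kernelBound_of_softKernel'`).
  So: 11686 = T ∧ Σ_radial; and 11686 ⟸ 17721 ∧ 17720 ∧ 11687, every one of which has its own seats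
  (routes IsotropyFromPowerCounting / PencilRigidity / MirrorModularBoosts / CertificationLength).
* What the radial kernel buys, and what it does not: levels `a ≤ 1` (degree-2 doubled orbits constant) — free here, two items
  (11687 + 11685) on the siblings; it does NOT bound the UV dimension (a radial kernel may be as singular at `0` as temperedness of
  `S₁ 2` allows, with no pointwise bound at all), so neither T nor even Σ's vacuum row follows from it: both residual inputs are UV
  statements about the Wilson limit of the curvature channel, and nothing in the crux's hypothesis list speaks about the UV.

Disproof.lean v7d honoured as in generations 4–11 (the tie is consumed by T and by Σ; every conclusion on `⁰𝒮`; junk is excluded by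
`NPointRegular`, which T delivers through the landed halves); 14999's Disproof §5: Σ holds on junk with `C = 0` and on every
certified inhabitant (`c ≡ 0` / `β ≡ 0` schemes, the vacuum) with `μ = 0`, so `stub_sandwichBoundRadial` is consistent with every
controlled scheme, exactly like T.

Everything else below is generation 11 verbatim (lead c5's text kept for the record), except that the dropped stubs are gone
(their names are listed above; their docstrings survive in the tree history) and `stub_tieRegularity` is now proved through the
landed glue `stub_stepZeroOfLattice` instead of inline.

## (Record) Generation 11 header — lead c5's text, verbatim
(stmt-QuantumFields-11686; continuation lead `prover-line-stmt-QuantumFields-11686-c5-0`; `Cruxes/NPointIsotropy/PICKED.md`)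

## What generation 11 is (2026-08-17T02Z, lead c5)

Generation 10 (lead c4, below) verbatim — the composition `NPointIsotropy_of` and its three OPEN inputs
`stub_temperedLatticeApproximants` (Step 0, the Yang–Mills UV input, shared with stmt-9663), `stub_doubledOrbitKernelHigh` (the
analytic input in degrees `n ≥ 2`, model-blind, universal form) and `stub_levelGrowthHigh` (the bet, shared) are unchanged — plus the
ROUTE ANALYSIS of the one provable residual, `stub_doubledOrbitKernelHigh`, recorded in `Lines/complex-rotation-bandlimit-gen11-analytic-input.md`
and certified by two registered SIDE STUBS (both CLOSED by wave 1 of this seat: p136811, p137289):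

* `stub_orbitGapsPlanarTube` — THE ORBIT GEOMETRY (positive): for a compactly supported `e₀`-time-ordered `F` of degree `n` there
  are `ε, δ > 0` such that for every complex angle `θ`, `|Re θ| < ε`, every point `x` of the support, every `i` and every `i < j`,
  the complexified rotated position `R_θ xᵢ` and gap `R_θ(xⱼ - xᵢ)` (tree convention `planeRot 0`: `ζ⁰ = cos θ a + sin θ b`,
  `ζ¹ = -sin θ a + cos θ b`) lie in the PLANAR TUBE `{Re ζ⁰ > |Im ζ¹|}` with the quantitative margin
  `Re ζ⁰ - |Im ζ¹| ≥ δ e^{-|Im θ|}` (indeed `= e^{-|Im θ|} (R_{Re θ}·)⁰`).  This is the statement that the whole complex-rotation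
  orbit of the doubled configuration is a configuration of the multi-slot planar tube `Tᵏ` of the landed slot operators
  `W(ζ⁰, ζ¹) = e^{-ζ⁰H + iζ¹P₁}` (`stub_operatorConeFamily`), for EVERY boost `Im θ` — the first lemma of any proof.
* `stub_twoSlotEnvelopeObstruction` — THE LEVEL-0 OBSTRUCTION (negative, pure several complex variables): in light-cone
  coordinates `(u, v) = (ζ⁰ + iζ¹, ζ⁰ - iζ¹)` a slot is `ℂ₊ × ℂ₊`, the Euclidean gaps are the totally real form `{v = ū}` and a
  boost by rapidity `χ` acts by `(u, v) ↦ (e^{-χ}u, e^{χ}v)`.  For TWO slots, the data available before any positivity is used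
  at complex points — Euclidean values and the one-slot continuations (the "cross" `X`: one slot anywhere in `ℂ₊²`, the other on
  its real form) — do NOT determine a holomorphic function at the doubly-boosted point `P_χ = (e^{-χ}wⱼ, e^{χ}w̄ⱼ)ⱼ` once
  `χ ≥ 3`: there is `f` holomorphic on a neighbourhood `U` of `X` (namely `1/(g - g(P_χ))`, `g = ∏ⱼ (log vⱼ - log uⱼ)`, with
  `Re g < π²` on `X` and `Re g(P_χ) ≥ 4χ² - π²`) that extends to NO connected open `E ⊇ X` containing `P_χ`.  So the doubled
  orbit kernel at large boosts is out of reach of "one-gap continuation + envelope of holomorphy"; the Schwarz/Gram steps of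
  Osterwalder–Schrader II Ch. V at COMPLEX points are necessary (as they are in OS II beyond `∑|arg ζⱼ| < π/2`).

THE VERDICT on `stub_doubledOrbitKernelHigh` (details and the proof route in the `.md`): it is TRUE and provable, but it is the
planar-tube analogue of OS II Thms. 4.1–4.2 WITHOUT E1 — the full Ch. V.2 tower (Malgrange–Zerner / cross-theorem envelope
step, holomorphic Gram vectors, Schwarz inequality between levels, exhaustion of the tube) and the Ch. VI.2 temperedness
recursion, for slots ranging over the planar tube `T ≅ ℂ₊ × ℂ₊` (two commuting contraction semigroups `e^{-uA} e^{-vB}`,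
`A, B = (H ∓ P₁)/2 ≥ 0` by the operator cone) with the EUCLIDEAN real form `{v = ū}` (a real disc in a Lie ball) in place
of OS's half-line in a half-plane, transverse coordinates smeared.  The tree's 60-kline OS II engine
(`Literature/MathematicalPhysics/QuantumFieldTheory/OS{SectorContinuation,LabelledStep,LabelledTower,Tempered*}`) is hard-wired to
one complex variable per slot with real form `arg = 0` and does not instantiate; the growth the stub allows (`C e^{2N|Im θ|}`, i.e.
polynomial in the inverse distance to the distinguished boundary of the bidisc) is exactly what such a tower yields.  This is
crux-sized (an item: "planar multi-slot continuation without E1"), serving stmt-9663, stmt-11686 and stmt-14999 at once through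
the registered interface (this stub / `stub_uniformPlanarBoostVectors`), which lead c4's F1 showed is the right typing.

Everything else below is generation 10 verbatim (lead c4's text kept for the record).

## What generation 10 is (2026-08-17T01Z, lead c4)

Generation 9 (lead c3, below) verbatim — the composition `NPointIsotropy_of` and its three OPEN inputs `stub_temperedLatticeApproximants`
(Step 0, the Yang–Mills UV input, shared with stmt-9663), `stub_doubledOrbitKernelHigh` (the analytic input in degrees `n ≥ 2`,
model-blind, universal form) and `stub_levelGrowthHigh` (the bet, shared) are unchanged — plus ONE new registered side stub and two
recorded design findings:

* NEW registered stub `stub_latticeApproximants_of_continuousRegular` — CLOSED by wave 1 of this seat (p135284 ACCEPTED,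
  `Theorems/PencilRigidityNPointIsotropyLatticeOfContinuousRegular.lean`): the CONVERSE of 9663's
  reshape-8 decomposition of Step 0.  If `𝔖ₙ|⁰𝒮` of a TIED family is integration against a function `W` continuous off the
  coincidence locus with the tempered pair-weight bound `‖W y‖ ≤ C (1+‖y‖)^N (1 + Σ_{i≠j} ‖yᵢ−yⱼ‖⁻¹)^N`, then the conclusion of
  `stub_temperedLatticeApproximants` holds at that `n` with the explicit witness `D_k(x) = Re W(a_k x)` (injective multi-sites are
  off the locus; the Riemann sums converge by 9663's landed `DominatedTieLimit.tendsto_riemannSum_piBox` and the flat decay of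
  off-diagonal test functions; `𝔖ₙ F ∈ ℝ` on real tensors by the tie).  With the landed halves (`stub_dominatedTieLimit`,
  `stub_regular_of_dominated`: lattice form ⇒ `NPointRegular`) this certifies that the lattice-side form of Step 0 carries NO
  Yang–Mills content beyond tempered regularity of the tied limit: Step 0 may be filed ONCE, in continuum language
  ("`𝔖ₙ|⁰𝒮` is a tempered function, continuous off the locus"), for 9663 / 11686 / 14999.
* DESIGN FINDING 1 (the analytic input is correctly typed; recorded so that no later seat re-types it pointwise).  A restatement of
  `stub_doubledOrbitKernelHigh` in the vocabulary of the tree's Osterwalder–Schrader programme (`OSTimeContinuation.lean` (A1),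
  `WightmanProofs.lean` (A₁₂): a FUNCTION `𝔚` on a tube with `𝔖ₘ H = ∫ 𝔚(ιx) H x`) must treat the transverse coordinates `x², x³`
  DISTRIBUTIONALLY: under the stub's hypotheses (E2 + translations, E0', E3, the eight planar frames, the planar cone, the
  direction-1 operator cone) there are families whose `𝔖₄` is NOT a function of the transverse coordinates off the locus (a
  reflection-positive Gaussian family with covariance `c(x⁰,x¹) δ(x²) δ(x³)`, `c` a two-dimensional free two-point function, meets
  every hypothesis), so a pointwise planar-tube continuation is FALSE as a universal statement, while the registered test-function
  form (transverse smearing built in) is true for them.  The universal quantifier over `S₁` cannot be narrowed to hypercubic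
  families either: the sieve's `stub_rayPositivity` applies the analytic input to the 45° pull-back `T = 𝔖 ∘ (R_{π/4}·)`, which keeps
  E2 (eight frames), E0', E3, translations and the planar cone but NOT `Hypercubic` (conjugating a signed permutation by `R_{π/4}` leaves
  `W(B₄)`), hence has no transverse operator cone.  Consequence for the planner: the promotable model-blind item is exactly the
  registered `stub_doubledOrbitKernelHigh` (equivalently its vector form `stub_uniformPlanarBoostVectors`): "OS II multi-slot
  continuation WITHOUT E1 on the planar tube, transverse directions smeared" — the tree's OS files (`OSTimeSlice`, `OSTimeSpaceSplit`,
  `OSTimeSmearedFunction`, …) are hard-wired to the split (complex time | pointwise space) that E1 affords and do not transfer.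
* DESIGN FINDING 2 (Step 0 cannot come from soft functional analysis of the tie).  Banach–Steinhaus on products of flat-function
  spaces `{f flat on Zᵢ}` (pairwise disjoint open complements) turns the tie into UNIFORM bounds of the lattice functionals on such
  products, but (i) the true moment density may oscillate at the lattice scale (compatible with the tie, violating any pointwise
  bound), and (ii) every tempered distribution on `⁰𝒮` — junk included — is the limit of Riemann sums of SOME lattice densities; so
  the existential `D` of `stub_temperedLatticeApproximants` is equivalent to tempered regularity of the LIMIT and is Yang–Mills input
  (uniform UV bounds on renormalised `tr F²` moments), as 9663's reshape 8 says.  Not formalised (no consumer).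

Everything else below is generation 9 verbatim (lead c3's text kept for the record).

## What generation 9 is (2026-08-16T19Z, lead c3)

Generation 8 (lead c2, 18:2xZ; text in the item's evidence, never crux-written because of a farm node incoherent on
`Theses.MirrorModularBoosts`) = generation 7 below + the record that DEGREE 1 of the analytic input is a THEOREM in the
universal form (`universalTwoPointMeasure` p115393 + `doubledOrbitKernel_degOne_of_universal` p116660, composed as
`doubledOrbitKernel_degOne`, p119427 ACCEPTED 18:18Z) and the registration of the `n ≥ 2` residual `stub_doubledOrbitKernelHigh`.
Generation 9 (this file) makes that fold REAL:

* `stub_doubledOrbitKernel` (the analytic input in all degrees) is now PROVED in this file from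
  `doubledOrbitKernel_degZero` (degree `0`: one-point configuration space, constant kernel, type `0` — proved below and
  landed as `Theorems/PencilRigidityNPointIsotropyDoubledOrbitKernelDegZero.lean`), the landed `doubledOrbitKernel_degOne`
  (degree `1`, imported), and the registered residual `stub_doubledOrbitKernelHigh` (degrees `n ≥ 2`, universal form; the ONLY
  analytic sorry left).  The three sorries of this file are therefore `stub_tieRegularity` (Step 0, shared with 9663, staffed
  there as `stub_temperedLatticeApproximants` + two LANDED analysis halves), `stub_doubledOrbitKernelHigh` (`n ≥ 2`; implies
  9663's reshape-9 stub of the same name, which carries the extra kernel triple), `stub_levelGrowthHigh` (the bet, shared).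
* CERTIFIED (support file `Theorems/PencilRigidityNPointIsotropyOfSibling.lean`, lead c3): the whole crux is IMPLIED BY THE
  SIBLING CRUX — `nPointIsotropy_of_curvatureBoostCovariance : CurvatureBoostCovariance → NPointIsotropy` (pure logic: both
  cruxes carry `W₁` and the eight frames and conclude `PlanarInvariant`; the sibling's extra hypothesis, the planar cone, is
  the landed 9664 theorem; the radial kernel is not used) and `nPointIsotropy_of_kernelBound_of_softKernel :
  CurvatureKernelBound → SoftKernelBoostCovariance → NPointIsotropy` (through the landed glue of stmt-15000).  So every proof
  of stmt-9663 closes stmt-11686 in one line; the three residual stubs are worked ONCE (on 9663) and land here by import.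
* Step 0 ALIGNED with 9663's reshape 8: `stub_tieRegularity` is now PROVED in this file exactly as in
  `Cruxes/CurvatureBoostCovariance/Lines/boosts_inherit_mirrors.lean` — from the registered YM input
  `stub_temperedLatticeApproximants` (byte-identical with 9663's stub; the ONLY Step-0 sorry) and the two LANDED analysis halves
  `BoostsInheritMirrors.stub_dominatedTieLimit` (p108509) and `BoostsInheritMirrors.stub_regular_of_dominated` (p109000), imported.
  So the three sorries of generation 9 are `stub_temperedLatticeApproximants`, `stub_doubledOrbitKernelHigh`, `stub_levelGrowthHigh`
  — each a registered stub of stmt-9663 as well (the second in a weaker, kernel-triple form there).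
* Everything else is generation 7 verbatim (below).

REGISTRATION NOTE (to every other seat): the LEAD owns the skeleton and its registration (`ledger skeleton check … --crux
stmt-QuantumFields-11686`, last writer wins). Please do NOT re-register a skeleton on this item — send reshapes as
`Lines/<slug>.gen<k>.lean` / evidence notes; the lead folds them in.

## What generation 7 is (2026-08-16, lead c2)

**Generation 6** (this seat, 14:1xZ) = generation 5 (seat c1) with `stub_planarCone` CLOSED: the shared item
stmt-QuantumFields-9664 `MirrorModularBoosts.PlanarSpectralCone` is a THEOREM in the tree
(`Theorems/MirrorModularBoostsPlanarSpectralCone.lean`, `PositivityDiscToOperatorCone.PlanarSpectralCone_of`, p90375).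

**Generation 7** (this file) ALIGNS the line with the LANDED complex-rotation machinery of the sibling crux
stmt-QuantumFields-9663 `MirrorModularBoosts.CurvatureBoostCovariance` (line `boosts-inherit-mirrors`, skeleton
`Cruxes/CurvatureBoostCovariance/Lines/boosts_inherit_mirrors.lean`, 13 files landed under
`Theorems/MirrorModularBoostsCurvatureBoostCovariance*.lean`), which was itself built on THIS line's idea and on its landed
Paley–Wiener lemma (`stub_bandlimit`, p75205) and mop-up (`PencilRigidityNPointIsotropyMopup*`).  The two cruxes differ only
in the two-point input: 9663 has the bare planar cone (and needs `CurvatureKernelBound` 11687 + `ShellRigidity` 11685 to make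
the two-point function radial), 11686 HAS the radial kernel as a hypothesis.  So:

* The currency becomes the DOUBLED orbit function `θ ↦ 𝔖_{n+m}(R_θ·(ΘF* ⊗ G))` (`F`, `G` compactly supported,
  `e₀`-time-ordered) instead of the plain orbit of a planar-generic `F`: the sibling's landed `stub_orbitBandlimit` (doubled
  orbits are trigonometric polynomials, from the uniform planar boost vectors) + `stub_rayPositivity` (BOOSTS INHERIT THE
  MIRRORS: the 2×2 Laurent pencil of the four doubled blocks is PSD on both half-lines `s > 0` — axis frames — and `s < 0` —
  diagonal frames, the cone theorem 9664 consumed a second time for the 45° pull-backs) + `stub_paritySieve` (PSD on `ℝ∖0` +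
  diagonal layers `≤ 1` ⇒ constant blocks) + `stub_doubledToInvariant` (doubled-orbit constancy ⇒ `PlanarInvariant`, needs the
  Step-0 residual) REPLACE this line's `stub_entire` + `stub_harmonicKill` + `stub_mopup` composition.  The monolithic bet
  `stub_harmonicKill` (the regular model-blind core in band-limited dress) is thereby CUT DOWN to the sibling's level-growth
  statement: at OS level `a`, given planar invariance in degrees `≤ 2a − 2`, the diagonal doubled pencil of a degree-`a` `F`
  has no layer `|k| ≥ 2`.
* **NEW THEOREM of generation 7 (`levelGrowthLow_of_radialKernel`, proved below, sorry-free): under the crux's RADIAL KERNEL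
  the level growth at levels `a ≤ 1` is FREE** — the degree-`2` doubled orbit of an `e₀`-time-ordered one-point `F` is
  off-diagonal, so `Negative.DegreeTwoFree.radialKernel_invariant_two` makes its orbit function constant and the sibling's
  landed `trigPoly_coeff_eq_zero_of_const` kills every non-zero layer.  (On 9663 the same step costs two PencilRigidity items.)
* The three remaining `sorry`s of this file are thereby EXACTLY the three named open inputs of the sibling skeleton, stated
  BYTE-FOR-BYTE as registered there (so that ONE proof, or ONE refutation, serves stmt-9663, stmt-11686 and stmt-14999):
  - `stub_tieRegularity` — Step 0 in the shared form `W1 + EightFrameRP + PlanarCone ⇒ NPointRegular` (all degrees; the cone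
    is supplied here by 9664).  On 9663 (reshape 8, lead c2, 13:44Z) it is PROVED from `stub_temperedLatticeApproximants`
    (XL, the Yang–Mills UV input in lattice language) + `stub_dominatedTieLimit` + `stub_regular_of_dominated` (model-blind,
    provable now, staffed THERE — not duplicated here); this file switches to that decomposition by import when they land.
  - `stub_doubledOrbitKernel` — THE analytic input in scalar form (OS II multi-slot continuation WITHOUT E1 along
    complex-rotation orbits of doubled configurations; XL; model-blind).  With the landed `stub_gramVecOnStrip` it gives the
    uniform planar boost vectors (`stub_uniformPlanarBoostVectors`, proved below verbatim as on 9663).  This is what the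
    wave-1 worker verdict on `stub_entire` ("blocked on the cone in multi-slot operator form + OS II sans E1") named; the
    cone half is now landed (9664 + `stub_operatorConeFamily`), the multi-slot half is this stub.
  - `stub_levelGrowthHigh` — level growth at levels `a ≥ 2`: THE BET (Yang–Mills input; uses the tie; XL; no engine on record;
    not refutable in any controlled scheme; false without the tie).
* LANDED BY THIS SEAT (generation 7, all ACCEPTED, `--supports` this crux): p108731 `Theorems/PencilRigidityNPointIsotropyCoreCertificate.lean`
  (`levelGrowthLow_of_radialKernel`, `uniformPlanarBoostVectors_of_kernel`, `planarInvariant_of_inputs`, THE CERTIFICATE `nPointIsotropy_of_inputs :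
  Step0 → doubledOrbitKernel → levelGrowthHigh → NPointIsotropy`); p109025 `…BetNecessary.lean` (`levelGrowthHighRadial_of_nPointIsotropy`: the
  radial bet is NECESSARY); p110004 `…NoLayersOfInvariant.lean` (`noLayers_of_planarInvariant`; `levelGrowthHigh_of_curvatureBoostCovariance`: the
  SHARED bet is implied by 9663's crux); p109963 `…ConeAllSpatial.lean` (`jointSpectralMeasure_cone_allSpatial`: Hypercubic + eight frames ⇒ the operator
  cone `H ≥ |P_i|` in ALL three spatial directions; `SpatialTransport.exists_unitary`: an isometry fixing `e₀` that leaves `S₁` invariant on `⁰𝒮` acts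
  unitarily INSIDE the `e₀`-reconstruction, intertwining `e^{-tH}` and `U(a⃗) ↦ U(σa⃗)`).  Wave 2 (R2 of the analytic stub, DEGREE 1, in the UNIVERSAL form —
  no kernel hypothesis, unlike 9663's reshape-9 route through sharp vectors + the UV kernel triple): helpers LANDED p111717 `…UniversalTwoPointMeasureSpectral`,
  p111724 `…Superposition`, p111725 `…Reference`, p111864 `…DoubledOrbitKernelDegOneToolbox`; PENDING on the gate behind the farm build lag (content kernel-checked rc0 as
  monoliths): p113753 `…UniversalTwoPointMeasure` (`universalTwoPointMeasure`: e₀-RP + translations ⇒ ONE tempered `μ₀` on `{p₀ ≥ 0}` with `μ_{Ψ_f} = |f̃|²μ₀`),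
  p113898 `…DegOneSymbol`, p114119 `…DegOneTransform`; to propose once those are built: `…DoubledOrbitKernelDegOne` (`doubledOrbitKernel_degOne_of_universal`:
  `μ₀` + operator cone ⇒ the `n = 1` case of `stub_doubledOrbitKernel`, type = half the temperedness order).  Sources: `Lines/complex-rotation-bandlimit-wave2-sources.md`.
  NOTE (16:0xZ): 9663's lead RESHAPED (reshape 9, 14:45Z) its analytic stub into `stub_sharpOnePointVectors` + `stub_doubledOrbitKernelOne` (degree 1 via the
  KERNEL TRIPLE with the UV bound `|K x| ≤ C(1+‖x‖^(η-10))`, which 11686's families do NOT have) + `stub_doubledOrbitKernelHigh` (`n ≥ 2`, kernel triple as extra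
  hypothesis); `stub_tieRegularity` and `stub_levelGrowthHigh` are still shared byte-for-byte, `stub_doubledOrbitKernel` (universal, all `n`) now lives here only —
  generation 8 (next cycle, once wave 2 is built) splits it into degree 0 (trivial), degree 1 (wave 2) and a universal `n ≥ 2` stub.
* Kept from generations 5–6 (all sorry-free): the one-point theorem THROUGH THE TIE (`onePoint_of_tie`,
  `degreeOne_invariant_of_tie`), the `⁰𝒮` tensor density and its consequences (`zeroSchwartz_density`, `tie_pins`,
  `betaZeroSlice`, `planarInvariant_of_tensors3`), degrees `≤ 2` of the crux unconditionally (`crux_degrees_le_two`), the closed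
  stubs `stub_planarCone` (9664), `stub_bandlimit`, `stub_mopup`, `stub_riemannSumBox`, `stub_latticeOnePointFactor`,
  `stub_onePointConst`, and the checks against the landed negatives.
* SUPERSEDED (not dead; nothing landed is orphaned): `stub_tieRegularity3` (`n ≥ 3` form — implied by the shared all-`n` form,
  degrees `≤ 2` being free anyway); `stub_entire` (implied by `stub_doubledOrbitKernel` + the sibling's landed
  `stub_orbitLocalContinuation` / `stub_orbitAllAngles` / `stub_orbitGluing`); `stub_harmonicKill` — a MODEL-BLIND bet (the regular
  core in band-limited dress) — is NOT implied but REPLACED by the TIED bet `stub_levelGrowthHigh`, a strictly weaker demand on the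
  line (it may use the lattice tie; its radial form is even necessary for the crux, `levelGrowthHighRadial_of_nPointIsotropy`).
  The old statements stay on record in `Lines/complex-rotation-bandlimit.lean` (planner gen 2) and gens 5/6 of this file.

GLOSSARY: `NPointRegular S₁` = `∀ n, ∃ W, ∀ F, IsOffDiagonal F → Integrable (W·F) ∧ S₁ n F = ∫ W·F` (every `𝔖ₙ|⁰𝒮` a
FUNCTION; junk violates it: `Negative.not_nPointRegular_junk`).  `NPointIsotropy_of` composes everything into the crux BY NAME.
-/

noncomputable section

-- Mathlib's `SimplexCategory` instance `Fintype (Fin (x.len + 1))` matches `Fintype (Fin 4)` and makes concrete `Fin 4` instance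
-- paths diverge between elaborations (tree-known file-local workaround, as in the landed `Negative/*.lean` files of this crux).
attribute [-instance] SimplexCategory.instFintypeToTypeOrderHomFinHAddNatLenOfNat

namespace Summit.QuantumFields.YangMills.Cruxes.NPointIsotropy.ComplexRotationBandlimit

open scoped BigOperators SchwartzMap InnerProductSpace
open MeasureTheory Filter Topology
open Literature.MathematicalPhysics.QuantumLattice Literature.MathematicalPhysics.AQFT
  Literature.MathematicalPhysics.QuantumFieldTheory
open Summit.QuantumFields.YangMills.Theorems.NPointIsotropy.Negative (E4 RadialKernel NPointRegular junk nPointIsotropy_iff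
  not_NPointIsotropyModelBlind not_NPointIsotropyWithoutTieAt4 radialKernel_invariant_two not_nPointRegular_junk)
open Summit.QuantumFields.YangMills.Theorems.CurvatureBoostCovariance.Negative
  (OSPackage Translations Hypercubic EightFrameRP PlanarCone PlanarInvariant Tie Gaps W1
    apply_linActMulti_eq_of_beta_zero)

/-! ## Generation 12b, §A — the FIRST open input: STEP 0 (item stmt-QuantumFields-17723), registered below as `stub_tieRegularity`

Generation 12b registers Step 0 in the WEAKEST form the composition consumes — `W1 → EightFrameRP → PlanarCone → NPointRegular`,
byte-identical with item stmt-QuantumFields-17723 `IsotropyFromPowerCounting.CurvatureDensities` — instead of its sufficient condition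
T (`stub_temperedLatticeApproximants` of generations 9–12 = item stmt-QuantumFields-17721 `IsotropyFromPowerCounting.TemperedCurvatureMoments`:
tempered renormalised lattice moment densities tied to `S₁ n` on off-diagonal real tensors).  T ⇒ Step 0 is LANDED (`stub_stepZeroOfT`,
p139269, kept below with T's full text as its hypothesis; also `curvatureDensities_of_temperedCurvatureMoments` by name in
`Theorems/IsotropyFromPowerCountingEngineFromPowerCounting.lean`), so nothing is lost and the registered residual is exactly what the
by-name certificate `nPointIsotropy_of_routeItems` (p140808) consumes.  The sorried Step-0 stub itself is `stub_tieRegularity` in §C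
(its statement has been byte-stable since generation 7). -/

/-! ## Generation 12, §A — the SECOND open stub: the sandwich bound asked of this crux's families -/

/-- **Stub 12Σ — THE TRANSVERSELY FILTERED HEAT-SANDWICH BOUND, ASKED OF THIS CRUX'S FAMILIES (`stub_sandwichBoundRadial`;
USES THE TIE; the Yang–Mills UV input that REPLACES the OS tower `stub_doubledOrbitKernelHigh` AND the bet `stub_levelGrowthHigh`
of generations 7–11; difficulty XL / research; registered by lead c6, generation 12).**  For every compact simple `G` (any Borel
structure), `r`, `sch` and one-species `S₁` with the curvature package `W1 r sch S₁`, reflection positivity in the eight planar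
frames and the RADIAL two-point kernel — verbatim the hypotheses of the crux — :
* (e₀) for every `e₀`-reconstruction `h` of `S₁` there are `μ < 4` and `C` with the sandwich bound: for all scales
  `0 < u, v ≤ 1`, every one-point insertion `f₁ = g ⊗ hh` (planar profile `g(x⁰, x¹)` with times in `[u, 2u]`, weighted by its
  `L¹` mass `Mg`; transverse profile `hh(x², x³)` controlled in `L¹` (`Mh`) AND `L^∞` (`Mh'`)) and every time-ordered `W` of any
  degree `n` pushed to times `> 2u + v`: `‖Ψ_{f₁ ⊗ W_{(2u+v)e₀}}‖ ≤ C · Mg · (Mh + Mh') · (u^{-μ} + v^{-μ}) · ‖Ψ_W‖`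
  — "`‖e^{-u'H} φ(g ⊗ hh) e^{-v'H}‖ ≤ C_{g,hh} (u'^{-μ} + v'^{-μ})` on the dense set of field vectors", one insertion of the
  dimension-4 curvature density costing STRICTLY LESS than `u⁻⁴` (power counting for `tr F²`: `μ = 3`; vacuum row of a kernel
  `≍ |x|^{η-10}`: `μ = 4 - η/2`, see `stub_sandwichVacuumRowOfKernel`);
* (45°) for every `e₀`-reconstruction `h'` of the 45° pull-back `n ↦ 𝔖ₙ ∘ (R_{π/4} ·)` (an `e₀`-RP family by `EightFrameRP`; its
  `e₀`-sandwich is the sandwich of `S₁` in the diagonal frame) a sandwich bound with SOME exponent `μ` and constant `C` — NO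
  threshold: the composition needs the pull-back's planar boost vectors only to EXIST (ray positivity of the doubled pencils on
  `s < 0` is a Gram statement of any exponential type), and the landed chain `stub_asmUniformBoost` builds them from a sandwich
  bound of any exponent.
This is 14999's registered `stub_sandwichBound` (= item stmt-QuantumFields-17720 `IsotropyFromPowerCounting.CurvatureSandwichBound`)
with (i) its kernel-triple antecedent replaced by this crux's `RadialKernel S₁` (and the idle `PlanarCone S₁` antecedent dropped —
it is a theorem here, `planarCone_of_W1`), (ii) the 45° threshold dropped.  IMPLIED BY THE ITEMS 17720 ∧ 11687
(`sandwichBoundRadial_of_items`, sorry-free).  Certified inhabitants (`c ≡ 0` / `β ≡ 0` schemes, the vacuum: c-number fields on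
`⁰𝒮`): `μ = 0`, `C = |κ|` (14999 Disproof §5); junk: `C = 0` (`sandwichBound_junk` there) — the tie enters because a genuine
Wilson limit must be shown to have UV dimension `< 4 + 1` in this operator sense.  The radial kernel does NOT help with it (a radial
kernel may be as singular at `0` as temperedness allows; the vacuum row ALONE forces `|K(x)| ≲ |x|^{-(2μ+4)}` on average, so this
stub carries a UV bound of the strength of `CurvatureKernelBound`'s).  A counterexample must be a subsequential Wilson limit of
`tr F²` strings with uniform lattice gap, radial two-point function and an insertion of dimension `≥ 5` in the sandwich sense. -/
theorem stub_sandwichBoundRadial :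
    open Literature.MathematicalPhysics.QuantumLattice Literature.MathematicalPhysics.AQFT
      Literature.MathematicalPhysics.QuantumFieldTheory
      Summit.QuantumFields.YangMills.Theorems.CurvatureBoostCovariance.Negative
      Summit.QuantumFields.YangMills.Theorems.NPointIsotropy.Negative in
    ∀ (G : Type) [Group G] [TopologicalSpace G] [IsTopologicalGroup G] [CompactSpace G]
      [MeasurableSpace G] [BorelSpace G], IsCompactSimpleLieGroup G →
      ∀ (r : LatticeRep G) (sch : SpeciesScheme (YMSpecies G)) (S₁ : SchwingerFamily E4),
        W1 r sch S₁ → EightFrameRP S₁ → RadialKernel S₁ →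
        (∀ (h : OSReconstructionNoE1 S₁.toLabelled), ∃ μ C : ℝ, μ < 4 ∧
          (∀ (u v : ℝ), 0 < u → 0 < v → u ≤ 1 → v ≤ 1 →
             ∀ (f₁ : SchwartzMap (Fin 1 → E4) ℂ) (g hh : ℝ × ℝ → ℂ) (Mg Mh Mh' : ℝ),
               (∀ x : Fin 1 → E4, f₁ x = g (x 0 0, x 0 1) * hh (x 0 2, x 0 3)) →
               (∀ p : ℝ × ℝ, g p ≠ 0 → u ≤ p.1 ∧ p.1 ≤ 2 * u) →
               MeasureTheory.Integrable g → (∫ p, ‖g p‖) ≤ Mg →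
               MeasureTheory.Integrable hh → (∫ p, ‖hh p‖) ≤ Mh → (∀ p, ‖hh p‖ ≤ Mh') →
             ∀ (n : ℕ) (W : SchwartzMap (Fin n → E4) ℂ) (hW : IsTimeOrdered W)
               (hFW : IsTimeOrdered
                 (SchwartzMap.appendTensor f₁ (translateMulti ((2 * u + v) • EuclideanSpace.single 0 1) W))),
               ‖h.fieldVec (1 + n) (fun _ => ())
                   (SchwartzMap.appendTensor f₁ (translateMulti ((2 * u + v) • EuclideanSpace.single 0 1) W)) hFW‖
                 ≤ C * Mg * (Mh + Mh') * (u ^ (-μ) + v ^ (-μ)) * ‖h.fieldVec n (fun _ => ()) W hW‖)) ∧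
        (∀ (h' : OSReconstructionNoE1 (SchwingerFamily.toLabelled
            (fun n => (S₁ n).comp (linActMulti (planeRot (0 : Fin 3) (Real.pi / 4)))))),
          ∃ μ C : ℝ,
          (∀ (u v : ℝ), 0 < u → 0 < v → u ≤ 1 → v ≤ 1 →
             ∀ (f₁ : SchwartzMap (Fin 1 → E4) ℂ) (g hh : ℝ × ℝ → ℂ) (Mg Mh Mh' : ℝ),
               (∀ x : Fin 1 → E4, f₁ x = g (x 0 0, x 0 1) * hh (x 0 2, x 0 3)) →
               (∀ p : ℝ × ℝ, g p ≠ 0 → u ≤ p.1 ∧ p.1 ≤ 2 * u) →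
               MeasureTheory.Integrable g → (∫ p, ‖g p‖) ≤ Mg →
               MeasureTheory.Integrable hh → (∫ p, ‖hh p‖) ≤ Mh → (∀ p, ‖hh p‖ ≤ Mh') →
             ∀ (n : ℕ) (W : SchwartzMap (Fin n → E4) ℂ) (hW : IsTimeOrdered W)
               (hFW : IsTimeOrdered
                 (SchwartzMap.appendTensor f₁ (translateMulti ((2 * u + v) • EuclideanSpace.single 0 1) W))),
               ‖h'.fieldVec (1 + n) (fun _ => ())
                   (SchwartzMap.appendTensor f₁ (translateMulti ((2 * u + v) • EuclideanSpace.single 0 1) W)) hFW‖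
                 ≤ C * Mg * (Mh + Mh') * (u ^ (-μ) + v ^ (-μ)) * ‖h'.fieldVec n (fun _ => ()) W hW‖)) := by
  sorry

/-! ## Generation 12, §B — registered PROVABLE stubs (wave 1 of lead c6) -/

/-- **Stub 12P — PLANAR INVARIANCE OF ONE FAMILY FROM ITS RADIAL INPUTS (`stub_planarInvariantOfInputsRadial`; the POINTWISE,
model-blind composition of generation 12; difficulty S given the landed chain; LANDED p138998 by lead c6 — the body below is the landed theorem).**
For a one-species family `S₁` on `ℝ⁴` with the OS package, translations and proper-hypercubic invariance on `⁰𝒮`, reflection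
positivity in the eight planar frames, the planar spectral cone and the RADIAL two-point kernel: IF every `𝔖ₙ|⁰𝒮` is a function
(`NPointRegular S₁`, Step 0), the `e₀`-sandwich bound holds with SOME exponent `μ < 4` for every `e₀`-reconstruction of `S₁`, and
a sandwich bound with SOME exponent holds for every `e₀`-reconstruction of the 45° pull-back, THEN `S₁` is invariant on `⁰𝒮`
under every rotation of the `(x₀,x₁)`-plane.  Proof on offer = 14999's landed `stub_planarInvariantOfInputs`
(`Theorems/MirrorModularBoostsSoftKernelBoostCovariancePlanarInvariantOfInputs.lean`, 52-line body) with TWO edits: `hlow` is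
`ComplexRotationBandlimit.levelGrowthLow_shape hK` (this crux's landed radial lemma, `…CoreCertificate.lean`) instead of
`levelGrowthLow_of_kernel_pointwise`, and the 45° datum is destructured as `⟨μT₀, CμT, hST₀⟩` (no threshold to discard).
Ingredients, all landed under `Theorems.SoftKernelBoostCovariance.Sketch`: `osReconstruction_of` / `*_pullBack` (RayPositivity),
`PlanarSpectralCone_of`, `stub_coneFamily`, `sandwich_mono_exponent`, `stub_asmUniformBoost`, `stub_asmTypedBoost`,
`stub_orbitBandlimitLocal`, `stub_rayPositivityLocal`, `boostVectors_of_uniform`, `stub_levelGrowthHigh_of_boostType`,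
`stub_laurentLayers`, `sieve_of_stubs`. -/
theorem stub_planarInvariantOfInputsRadial :
    open Literature.MathematicalPhysics.QuantumLattice Literature.MathematicalPhysics.AQFT
      Literature.MathematicalPhysics.QuantumFieldTheory
      Summit.QuantumFields.YangMills.Theorems.CurvatureBoostCovariance.Negative
      Summit.QuantumFields.YangMills.Theorems.NPointIsotropy.Negative in
    ∀ (S₁ : SchwingerFamily E4), OSPackage S₁ → Translations S₁ → Hypercubic S₁ → EightFrameRP S₁ → PlanarCone S₁ →
      RadialKernel S₁ → NPointRegular S₁ →
      (∀ (h : OSReconstructionNoE1 S₁.toLabelled), ∃ μ C : ℝ, μ < 4 ∧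
        (∀ (u v : ℝ), 0 < u → 0 < v → u ≤ 1 → v ≤ 1 →
           ∀ (f₁ : SchwartzMap (Fin 1 → E4) ℂ) (g hh : ℝ × ℝ → ℂ) (Mg Mh Mh' : ℝ),
             (∀ x : Fin 1 → E4, f₁ x = g (x 0 0, x 0 1) * hh (x 0 2, x 0 3)) →
             (∀ p : ℝ × ℝ, g p ≠ 0 → u ≤ p.1 ∧ p.1 ≤ 2 * u) →
             MeasureTheory.Integrable g → (∫ p, ‖g p‖) ≤ Mg →
             MeasureTheory.Integrable hh → (∫ p, ‖hh p‖) ≤ Mh → (∀ p, ‖hh p‖ ≤ Mh') →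
           ∀ (n : ℕ) (W : SchwartzMap (Fin n → E4) ℂ) (hW : IsTimeOrdered W)
             (hFW : IsTimeOrdered
               (SchwartzMap.appendTensor f₁ (translateMulti ((2 * u + v) • EuclideanSpace.single 0 1) W))),
             ‖h.fieldVec (1 + n) (fun _ => ())
                 (SchwartzMap.appendTensor f₁ (translateMulti ((2 * u + v) • EuclideanSpace.single 0 1) W)) hFW‖
               ≤ C * Mg * (Mh + Mh') * (u ^ (-μ) + v ^ (-μ)) * ‖h.fieldVec n (fun _ => ()) W hW‖)) →
      (∀ (h' : OSReconstructionNoE1 (SchwingerFamily.toLabelled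
          (fun n => (S₁ n).comp (linActMulti (planeRot (0 : Fin 3) (Real.pi / 4)))))),
        ∃ μ C : ℝ,
        (∀ (u v : ℝ), 0 < u → 0 < v → u ≤ 1 → v ≤ 1 →
           ∀ (f₁ : SchwartzMap (Fin 1 → E4) ℂ) (g hh : ℝ × ℝ → ℂ) (Mg Mh Mh' : ℝ),
             (∀ x : Fin 1 → E4, f₁ x = g (x 0 0, x 0 1) * hh (x 0 2, x 0 3)) →
             (∀ p : ℝ × ℝ, g p ≠ 0 → u ≤ p.1 ∧ p.1 ≤ 2 * u) →
             MeasureTheory.Integrable g → (∫ p, ‖g p‖) ≤ Mg →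
             MeasureTheory.Integrable hh → (∫ p, ‖hh p‖) ≤ Mh → (∀ p, ‖hh p‖ ≤ Mh') →
           ∀ (n : ℕ) (W : SchwartzMap (Fin n → E4) ℂ) (hW : IsTimeOrdered W)
             (hFW : IsTimeOrdered
               (SchwartzMap.appendTensor f₁ (translateMulti ((2 * u + v) • EuclideanSpace.single 0 1) W))),
             ‖h'.fieldVec (1 + n) (fun _ => ())
                 (SchwartzMap.appendTensor f₁ (translateMulti ((2 * u + v) • EuclideanSpace.single 0 1) W)) hFW‖
               ≤ C * Mg * (Mh + Mh') * (u ^ (-μ) + v ^ (-μ)) * ‖h'.fieldVec n (fun _ => ()) W hW‖)) →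
      PlanarInvariant S₁ :=
  -- LANDED (wave 1 of lead c6): the Theorems file proves the registered signature verbatim
  Summit.QuantumFields.YangMills.Theorems.NPointIsotropy.ComplexRotationBandlimit.stub_planarInvariantOfInputsRadial

/-- **Stub 12T — STEP 0 FOR ALL FAMILIES FROM T (`stub_stepZeroOfT`; pure logic over the landed glue; difficulty S; LANDED p139269,
wave 1 of lead c6 — the body below is the landed theorem).**  The shared Yang–Mills residual T (verbatim the registered `stub_temperedLatticeApproximants` = item
stmt-QuantumFields-17721) implies Step 0 in the shared form `W1 → EightFrameRP → PlanarCone → NPointRegular` (= item 17723's text),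
for every compact simple `G` with any Borel structure: normalisation is inside `W1`, and 14999's landed `stub_stepZeroOfLattice`
(`Theorems/MirrorModularBoostsSoftKernelBoostCovarianceStepZeroOfLattice.lean`) turns the tempered tied approximants into densities.
Proof on offer: `fun hT G … hG r sch S₁ hW h8 hC => stub_stepZeroOfLattice sch.a sch.L S₁ sch.a_pos sch.tendsto_a sch.tendsto_L
hW.2.1.1 (fun n hn => hT G hG r sch S₁ hW h8 hC n hn)`.  Its file carries the BY-NAME certificate over the three existing items
(`nPointIsotropy_of_items`: T → Σ (17720) → `PencilRigidity.CurvatureKernelBound` → `PencilRigidity.NPointIsotropy`). -/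
theorem stub_stepZeroOfT :
    open Literature.MathematicalPhysics.QuantumLattice Literature.MathematicalPhysics.AQFT
      Literature.MathematicalPhysics.QuantumFieldTheory Literature.Probability.LatticeModels
      Summit.QuantumFields.YangMills.Theorems.CurvatureBoostCovariance.Negative
      Summit.QuantumFields.YangMills.Theorems.NPointIsotropy.Negative in
    (∀ (G : Type) [Group G] [TopologicalSpace G] [IsTopologicalGroup G] [CompactSpace G]
      [MeasurableSpace G] [BorelSpace G], IsCompactSimpleLieGroup G →
      ∀ (r : LatticeRep G) (sch : SpeciesScheme (YMSpecies G)) (S₁ : SchwingerFamily E4),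
        W1 r sch S₁ → EightFrameRP S₁ → PlanarCone S₁ →
        ∀ n : ℕ, 0 < n → ∃ (D : ℕ → (Fin n → Site 4) → ℝ) (C : ℝ) (N k₀ : ℕ), 0 < C ∧
          (∀ k : ℕ, k₀ ≤ k → ∀ x : Fin n → Site 4, (∀ i, x i ∈ box 4 (sch.L k)) → Function.Injective x →
            |D k x| ≤ C * (1 + ‖fun i => sch.a k • siteToE (x i)‖) ^ N *
              (1 + ∑ i, ∑ j ∈ Finset.univ.erase i,
                ‖sch.a k • siteToE (x i) - sch.a k • siteToE (x j)‖⁻¹) ^ N) ∧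
          ∀ (f : Fin n → SchwartzMap E4 ℝ) (F : SchwartzMap (Fin n → E4) ℂ),
            IsTensorOf F (fun i => ofRealTest (f i)) → IsOffDiagonal F →
            Filter.Tendsto (fun k => (((sch.a k ^ 4) ^ n *
              ∑ x ∈ Fintype.piFinset (fun _ : Fin n => box 4 (sch.L k)),
                (∏ i, f i (sch.a k • siteToE (x i))) * D k x : ℝ) : ℂ)) Filter.atTop (nhds (S₁ n F))) →
    ∀ (G : Type) [Group G] [TopologicalSpace G] [IsTopologicalGroup G] [CompactSpace G]
      [MeasurableSpace G] [BorelSpace G], IsCompactSimpleLieGroup G →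
      ∀ (r : LatticeRep G) (sch : SpeciesScheme (YMSpecies G)) (S₁ : SchwingerFamily E4),
        W1 r sch S₁ → EightFrameRP S₁ → PlanarCone S₁ → NPointRegular S₁ :=
  -- LANDED (wave 1 of lead c6): the Theorems file proves the registered signature verbatim
  Summit.QuantumFields.YangMills.Theorems.NPointIsotropy.ComplexRotationBandlimit.stub_stepZeroOfT

/-- **Stub 12V — CALIBRATION: THE VACUUM ROW OF Σ IS A THEOREM UNDER THE KERNEL TRIPLE, WITH EXPONENT `4 - η/2`
(`stub_sandwichVacuumRowOfKernel`; model-blind real analysis + the OS inner-product formula; difficulty M–L; PROVED in the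
lead's folder and LANDED (wave 1, W3; helpers p140722, stub file p140939); registered by lead c6 — the body below is the landed theorem).**  For a one-species family `S₁` with an `e₀`-reconstruction `h`, normalised in degree `0`
(`𝔖₀ F = F()`), whose two-point function on `⁰𝒮` is a kernel `K(x₀ − x₁)`, continuous off `0`, with `|K x| ≤ C (1 + ‖x‖^(η−10))`, `0 < η ≤ 2`:
there is `C'` (depending on `C, η` only) such that for all `0 < u, v ≤ 1`, every factorised one-point insertion `f₁ = g ⊗ hh` with
the times of `g` in `[u, 2u]`, `∫|g| ≤ Mg`, `∫|hh| ≤ Mh`, `|hh| ≤ Mh'`, and every DEGREE-ZERO `W` (a constant `c`):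
`‖Ψ_{f₁ ⊗ W}‖ ≤ C' · Mg · (Mh + Mh') · (u^{-(4-η/2)} + v^{-(4-η/2)}) · ‖Ψ_W‖` — the `n = 0` row of Σ with `μ = 4 - η/2 < 4`.
Proof on offer: `Ψ_{f₁ ⊗ W} = c · Ψ_{f₁}` and `‖Ψ_W‖ = |c|` (`inner_fieldVec_fieldVec` + normalisation);
`‖Ψ_{f₁}‖² = 𝔖₂(Θf̄₁ ⊗ f₁) = ∫∫ K(x − y) f̄₁(θx) f₁(y)` (the doubled test function is off-diagonal: times in `[−2u,−u]` vs
`[u,2u]`), `|θx − y| ≥ |x⁰ + y⁰| ≥ 2u`, so `|K(θx − y)| ≤ C (1 + (4u² + |x_⊥' − y_⊥'|²)^{(η−10)/2})` with `⊥' = (x², x³)`; integrate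
`y_⊥'` first: `∫ |K| |hh| dy_⊥' ≤ C Mh + C Mh' ∫_{ℝ²} (4u² + |w|²)^{(η−10)/2} dw = C Mh + C Mh' · (2π/(8−η)) (2u)^{η−8}`; then
`∫ |g| ≤ Mg` and `∫ |f₁| ≤ Mg Mh` give `‖Ψ_{f₁}‖² ≤ Mg² Mh (C Mh + C_η Mh' u^{η−8}) ≤ C'² Mg² (Mh + Mh')² u^{η−8}` (`u ≤ 1`).
Meaning: Σ's exponent convention is right — on the vacuum row `μ < 4 ⟺ η > 0`, i.e. two-point UV degree `< 10`
("dimension `< 5`"), as 14999's card and Disproof §5 state on paper; the isotropic dimension-4 free `tr F²`-like kernel `|x|⁻⁸`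
(`η = 2`) has `μ = 3`. -/
theorem stub_sandwichVacuumRowOfKernel :
    open Literature.MathematicalPhysics.QuantumLattice Literature.MathematicalPhysics.AQFT
      Literature.MathematicalPhysics.QuantumFieldTheory
      Summit.QuantumFields.YangMills.Theorems.NPointIsotropy.Negative in
    ∀ (S₁ : SchwingerFamily E4) (h : OSReconstructionNoE1 S₁.toLabelled), S₁.toLabelled.IsNormalized →
      ∀ (K : E4 → ℝ) (C η : ℝ), 0 < η → η ≤ 2 → ContinuousOn K {x : E4 | x ≠ 0} →
        (∀ x : E4, x ≠ 0 → |K x| ≤ C * (1 + ‖x‖ ^ (η - 10))) →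
        (∀ F : SchwartzMap (Fin 2 → E4) ℂ, IsOffDiagonal F →
            MeasureTheory.Integrable (fun x : Fin 2 → E4 => (K (x 0 - x 1) : ℂ) * F x) ∧
              S₁ 2 F = ∫ x : Fin 2 → E4, (K (x 0 - x 1) : ℂ) * F x) →
        ∃ C' : ℝ, ∀ (u v : ℝ), 0 < u → 0 < v → u ≤ 1 → v ≤ 1 →
           ∀ (f₁ : SchwartzMap (Fin 1 → E4) ℂ) (g hh : ℝ × ℝ → ℂ) (Mg Mh Mh' : ℝ),
             (∀ x : Fin 1 → E4, f₁ x = g (x 0 0, x 0 1) * hh (x 0 2, x 0 3)) →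
             (∀ p : ℝ × ℝ, g p ≠ 0 → u ≤ p.1 ∧ p.1 ≤ 2 * u) →
             MeasureTheory.Integrable g → (∫ p, ‖g p‖) ≤ Mg →
             MeasureTheory.Integrable hh → (∫ p, ‖hh p‖) ≤ Mh → (∀ p, ‖hh p‖ ≤ Mh') →
           ∀ (W : SchwartzMap (Fin 0 → E4) ℂ) (hW : IsTimeOrdered W)
             (hFW : IsTimeOrdered
               (SchwartzMap.appendTensor f₁ (translateMulti ((2 * u + v) • EuclideanSpace.single 0 1) W))),
             ‖h.fieldVec (1 + 0) (fun _ => ())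
                 (SchwartzMap.appendTensor f₁ (translateMulti ((2 * u + v) • EuclideanSpace.single 0 1) W)) hFW‖
               ≤ C' * Mg * (Mh + Mh') * (u ^ (-(4 - η / 2)) + v ^ (-(4 - η / 2))) *
                 ‖h.fieldVec 0 (fun _ => ()) W hW‖ :=
  -- LANDED (wave 1 of lead c6, W3): the Theorems file proves the registered signature verbatim
  Summit.QuantumFields.YangMills.Theorems.NPointIsotropy.ComplexRotationBandlimit.stub_sandwichVacuumRowOfKernel

/-! ## Generation 12b, §C — Step 0: the registered stub (item stmt-17723) and its landed sufficient condition T -/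

/-- **Stub 1 — STEP 0, SHARED FORM (`W1 + EightFrameRP + PlanarCone ⇒ NPointRegular`; OPEN REGISTERED STUB of generation 12b =
item stmt-QuantumFields-17723 `IsotropyFromPowerCounting.CurvatureDensities`, byte-identical; USES THE TIE at every order; difficulty XL
as a whole — it is the Yang–Mills UV input "Step 0"; implied by T = stmt-17721 through the LANDED `stub_stepZeroOfT`).**
For every compact simple `G` (any Borel structure), `r`, `sch` and one-species `S₁` with the curvature package `W1 r sch S₁`, the eight
planar frames and the planar cone: every `𝔖ₙ|⁰𝒮` is a FUNCTION.  Honours `not_NPointIsotropyWithoutTieAt4` (junk violates the conclusion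
at `n = 4`: `not_nPointRegular_junk`); certified inhabitants (`c ≡ 0`: `Wₙ = 0`; `β_k = 0` frequently: `Wₙ = κⁿ`; vacuum) satisfy it.
(Generations 9–12 proved this stub from the sorried T through `Sketch.stub_stepZeroOfLattice`; generation 12b moves the `sorry` here,
to the weaker statement, and keeps T ⇒ Step 0 as the landed `stub_stepZeroOfT`.) -/
theorem stub_tieRegularity :
    open Literature.MathematicalPhysics.QuantumLattice Literature.MathematicalPhysics.AQFT
      Literature.MathematicalPhysics.QuantumFieldTheory
      Summit.QuantumFields.YangMills.Theorems.CurvatureBoostCovariance.Negative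
      Summit.QuantumFields.YangMills.Theorems.NPointIsotropy.Negative in
    ∀ (G : Type) [Group G] [TopologicalSpace G] [IsTopologicalGroup G] [CompactSpace G]
      [MeasurableSpace G] [BorelSpace G], IsCompactSimpleLieGroup G →
      ∀ (r : LatticeRep G) (sch : SpeciesScheme (YMSpecies G)) (S₁ : SchwingerFamily E4),
        W1 r sch S₁ → EightFrameRP S₁ → PlanarCone S₁ → NPointRegular S₁ := by
  sorry

/-- **Stub 1d — STEP 0, CONTINUUM ⇒ LATTICE (generation 10, lead c4; registered side stub; CLOSED by wave 1, p135284).**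
The CONVERSE of 9663's reshape-8 decomposition of Step 0: for a family TIED to `(r, sch)` whose `𝔖ₙ|⁰𝒮` (`n ≥ 1`) is integration
against a function `W` that is continuous off the coincidence locus and obeys the tempered pair-weight bound, the conclusion of
`stub_temperedLatticeApproximants` holds at `n` — witness `D_k(x) := Re W(a_k • x)` (an injective lattice multi-site scaled by
`a_k > 0` is off the locus, so the bound is the hypothesis read at that point; `k₀ = 0`), and the Riemann sums
`(a_k⁴)ⁿ Σ_{x ∈ (box 4 L_k)ⁿ} (∏ fᵢ(a_k xᵢ)) D_k(x) = (a_k⁴)ⁿ Σ_x Re (W·F)(a_k x)` converge to `∫ Re (W·F) = Re 𝔖ₙ(F) = 𝔖ₙ(F)` by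
9663's landed `DominatedTieLimit.tendsto_riemannSum_piBox` (decay exponent `8n > 4n` from `DominatedTieLimit.flat_decay_pairWeight`
with `α = N + 8n`, `β = N`; a.e. continuity off the null locus `DominatedTieLimit.volume_coincidenceLocus`), the last equality because
`𝔖ₙ(F)` is a limit of real lattice numbers (the tie) on real tensors.  Meaning: the lattice-side typing of the Yang–Mills input of
Step 0 is implied by (and, through the landed halves, implies up to continuity) the continuum statement "`𝔖ₙ|⁰𝒮` is a tempered
function"; the planner may file Step 0 once in either language.  Only the tie is assumed (no OS clause, no `G`-hypothesis). -/
theorem stub_latticeApproximants_of_continuousRegular :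
    open Literature.MathematicalPhysics.QuantumLattice Literature.MathematicalPhysics.AQFT
      Literature.MathematicalPhysics.QuantumFieldTheory Literature.Probability.LatticeModels
      Summit.QuantumFields.YangMills.Theorems.CurvatureBoostCovariance.Negative
      Summit.QuantumFields.YangMills.Theorems.NPointIsotropy.Negative in
    ∀ (G : Type) [Group G] [TopologicalSpace G] [IsTopologicalGroup G] [CompactSpace G]
      [MeasurableSpace G] [BorelSpace G],
      ∀ (r : LatticeRep G) (sch : SpeciesScheme (YMSpecies G)) (S₁ : SchwingerFamily E4),
        Tie r sch S₁ →
        ∀ n : ℕ, 0 < n →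
          (∃ (W : (Fin n → E4) → ℂ) (C : ℝ) (N : ℕ), 0 < C ∧ ContinuousOn W (coincidenceLocus n E4)ᶜ ∧
            (∀ y ∉ coincidenceLocus n E4,
              ‖W y‖ ≤ C * (1 + ‖y‖) ^ N * (1 + ∑ i, ∑ j ∈ Finset.univ.erase i, ‖y i - y j‖⁻¹) ^ N) ∧
            ∀ F : SchwartzMap (Fin n → E4) ℂ, IsOffDiagonal F →
              MeasureTheory.Integrable (fun y : Fin n → E4 => W y * F y) ∧
              S₁ n F = ∫ y : Fin n → E4, W y * F y) →
          ∃ (D : ℕ → (Fin n → Site 4) → ℝ) (C : ℝ) (N k₀ : ℕ), 0 < C ∧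
            (∀ k : ℕ, k₀ ≤ k → ∀ x : Fin n → Site 4, (∀ i, x i ∈ box 4 (sch.L k)) → Function.Injective x →
              |D k x| ≤ C * (1 + ‖fun i => sch.a k • siteToE (x i)‖) ^ N *
                (1 + ∑ i, ∑ j ∈ Finset.univ.erase i,
                  ‖sch.a k • siteToE (x i) - sch.a k • siteToE (x j)‖⁻¹) ^ N) ∧
            ∀ (f : Fin n → SchwartzMap E4 ℝ) (F : SchwartzMap (Fin n → E4) ℂ),
              IsTensorOf F (fun i => ofRealTest (f i)) → IsOffDiagonal F →
              Filter.Tendsto (fun k => (((sch.a k ^ 4) ^ n *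
                ∑ x ∈ Fintype.piFinset (fun _ : Fin n => box 4 (sch.L k)),
                  (∏ i, f i (sch.a k • siteToE (x i))) * D k x : ℝ) : ℂ)) Filter.atTop (nhds (S₁ n F)) :=
  -- CLOSED by wave 1 of lead c4 (p135284, `Theorems/PencilRigidityNPointIsotropyLatticeOfContinuousRegular.lean`)
  Summit.QuantumFields.YangMills.Theorems.NPointIsotropy.ComplexRotationBandlimit.stub_latticeApproximants_of_continuousRegular

/-- **Step 0 in continuum language (generation 10): tempered-continuous regularity of the tied limit implies Step 0's lattice form
and hence (through the landed halves) `NPointRegular` — pure logic over Stub 1d; recorded so that the planner sees both typings of the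
Yang–Mills input side by side.** -/
theorem temperedLatticeApproximants_of_continuousRegular
    {G : Type} [Group G] [TopologicalSpace G] [IsTopologicalGroup G] [CompactSpace G] [MeasurableSpace G] [BorelSpace G]
    (r : LatticeRep G) (sch : SpeciesScheme (YMSpecies G)) (S₁ : SchwingerFamily E4) (htie : Tie r sch S₁)
    (hreg : ∀ n : ℕ, 0 < n → ∃ (W : (Fin n → E4) → ℂ) (C : ℝ) (N : ℕ), 0 < C ∧
      ContinuousOn W (coincidenceLocus n E4)ᶜ ∧
      (∀ y ∉ coincidenceLocus n E4,
        ‖W y‖ ≤ C * (1 + ‖y‖) ^ N * (1 + ∑ i, ∑ j ∈ Finset.univ.erase i, ‖y i - y j‖⁻¹) ^ N) ∧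
      ∀ F : 𝓢((Fin n → E4), ℂ), IsOffDiagonal F →
        Integrable (fun y : Fin n → E4 => W y * F y) ∧ S₁ n F = ∫ y : Fin n → E4, W y * F y)
    (n : ℕ) (hn : 0 < n) :
    ∃ (D : ℕ → (Fin n → Literature.Probability.LatticeModels.Site 4) → ℝ) (C : ℝ) (N k₀ : ℕ), 0 < C ∧
      (∀ k : ℕ, k₀ ≤ k → ∀ x : Fin n → Literature.Probability.LatticeModels.Site 4,
        (∀ i, x i ∈ Literature.Probability.LatticeModels.box 4 (sch.L k)) → Function.Injective x →
        |D k x| ≤ C * (1 + ‖fun i => sch.a k • siteToE (x i)‖) ^ N *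
          (1 + ∑ i, ∑ j ∈ Finset.univ.erase i, ‖sch.a k • siteToE (x i) - sch.a k • siteToE (x j)‖⁻¹) ^ N) ∧
      ∀ (f : Fin n → 𝓢(E4, ℝ)) (F : 𝓢((Fin n → E4), ℂ)),
        IsTensorOf F (fun i => ofRealTest (f i)) → IsOffDiagonal F →
        Tendsto (fun k => (((sch.a k ^ 4) ^ n *
          ∑ x ∈ Fintype.piFinset (fun _ : Fin n => Literature.Probability.LatticeModels.box 4 (sch.L k)),
            (∏ i, f i (sch.a k • siteToE (x i))) * D k x : ℝ) : ℂ)) atTop (𝓝 (S₁ n F)) :=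
  stub_latticeApproximants_of_continuousRegular G r sch S₁ htie n hn (hreg n hn)


/-! ## (Record) Generation 11 side stubs and degree 0 of the doubled orbit kernel (CLOSED; the OS-tower stub they served,
`stub_doubledOrbitKernelHigh`, is SUPERSEDED in generation 12 — see the header) -/

/-- **Side stub 11a — THE ORBIT GEOMETRY: complex-rotation orbits of time-ordered configurations stay in the planar tube,
with margin `δ e^{-|Im θ|}` (generation 11, lead c5; registered side stub; CLOSED by wave 1, p136811,
`Theorems/PencilRigidityNPointIsotropyOrbitGapsPlanarTube.lean`; pure real/complex trigonometry + compactness).**  For a compactly supported `e₀`-time-ordered `F` of degree `n` there are `ε, δ > 0` such that for every complex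
angle `θ` with `|Re θ| < ε`, every `x ∈ tsupport F`, every `i` (position relative to the rotation centre = the origin, which lies
on the mirror) and every `i < j` (gaps), writing `(a, b)` for the `(x⁰, x¹)`-components of `xᵢ` resp. `xⱼ - xᵢ` and
`ζ⁰ = cos θ a + sin θ b`, `ζ¹ = -sin θ a + cos θ b` for the components of the complexified rotated vector (tree convention
`planeRot 0 θ`), one has `Re ζ⁰ - |Im ζ¹| ≥ δ e^{-|Im θ|}`.  Proof on offer: with `θ = η + iχ`,
`Re ζ⁰ = cosh χ (cos η a + sin η b)` and `Im ζ¹ = -sinh χ (cos η a + sin η b)`, so `Re ζ⁰ - |Im ζ¹| = e^{-|χ|} (R_η ·)⁰`;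
and `(R_η xᵢ)⁰`, `(R_η (xⱼ - xᵢ))⁰ ≥ δ` for `|η| ≤ ε`, `x ∈ tsupport F` by compactness of the support inside the open ordered
chamber `{0 < x₁⁰ < ⋯ < xₙ⁰}` (cf. the landed `RayPositivity.exists_isTimeOrdered_planeRot`).  Meaning: every slot of the doubled
configuration `Θ(R_θ̄F)* ⊗ R_θF` carries a parameter of the planar tube `{|Im ζ¹| < Re ζ⁰}` of the landed slot operators
`W(ζ⁰, ζ¹) = e^{-ζ⁰H + iζ¹P₁}` (`stub_operatorConeFamily`) for EVERY boost `χ`, with the margin that feeds the growth bound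
`e^{2N|χ|}`; it is the first lemma of any proof of `stub_doubledOrbitKernelHigh`. -/
theorem stub_orbitGapsPlanarTube :
    ∀ (n : ℕ) (F : SchwartzMap (Fin n → EuclideanSpace ℝ (Fin 4)) ℂ),
      Literature.MathematicalPhysics.QuantumLattice.IsTimeOrdered F →
      HasCompactSupport (F : (Fin n → EuclideanSpace ℝ (Fin 4)) → ℂ) →
      ∃ ε : ℝ, 0 < ε ∧ ∃ δ : ℝ, 0 < δ ∧ ∀ θ : ℂ, |θ.re| < ε →
        ∀ x ∈ tsupport (F : (Fin n → EuclideanSpace ℝ (Fin 4)) → ℂ),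
          (∀ i : Fin n, δ * Real.exp (-|θ.im|) ≤
            (Complex.cos θ * ((x i 0 : ℝ) : ℂ) + Complex.sin θ * ((x i 1 : ℝ) : ℂ)).re -
              |(-Complex.sin θ * ((x i 0 : ℝ) : ℂ) + Complex.cos θ * ((x i 1 : ℝ) : ℂ)).im|) ∧
          (∀ i j : Fin n, i < j → δ * Real.exp (-|θ.im|) ≤
            (Complex.cos θ * ((x j 0 - x i 0 : ℝ) : ℂ) + Complex.sin θ * ((x j 1 - x i 1 : ℝ) : ℂ)).re -
              |(-Complex.sin θ * ((x j 0 - x i 0 : ℝ) : ℂ) + Complex.cos θ * ((x j 1 - x i 1 : ℝ) : ℂ)).im|) :=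
  -- CLOSED (generation 11, wave 1): landed `Theorems/PencilRigidityNPointIsotropyOrbitGapsPlanarTube.lean`
  Summit.QuantumFields.YangMills.Theorems.NPointIsotropy.ComplexRotationBandlimit.stub_orbitGapsPlanarTube

/-- **Side stub 11b — THE LEVEL-0 OBSTRUCTION: two slots cannot both be boosted far by function theory alone (generation 11,
lead c5; registered side stub; CLOSED by wave 1, p137289, `Theorems/PencilRigidityNPointIsotropyTwoSlotEnvelopeObstruction.lean`;
pure several complex variables).**  Light-cone coordinates of a slot:
`(u, v) ∈ ℂ₊ × ℂ₊` (`u = ζ⁰ + iζ¹`, `v = ζ⁰ - iζ¹`; the planar tube `{|Im ζ¹| < Re ζ⁰}` is exactly `Re u > 0 ∧ Re v > 0`);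
Euclidean (real) gaps are the totally real form `{v = ū}`; a boost by rapidity `χ` is `(u, v) ↦ (e^{-χ}u, e^{χ}v)`.  For two
slots let `Ω = (ℂ₊ × ℂ₊)²`, let `X ⊆ Ω` be the CROSS (one slot free, the other on its real form — the locus where the
Euclidean data and the landed one-gap continuations `stub_operatorConeFamily` give the doubled Schwinger function), and let
`P_χ = (e^{-χ}wⱼ, e^{χ}w̄ⱼ)ⱼ` be the doubly-boosted image of the Euclidean gaps `wⱼ ∈ ℂ₊`.  If `χ ≥ 3` there are an open
`U` with `X ⊆ U ⊆ Ω` and `f` holomorphic on `U` such that NO function analytic on a preconnected open `E` with `X ⊆ E ⊆ Ω`,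
`P_χ ∈ E`, agrees with `f` on `U ∩ E`.  Proof on offer: `g(z) = ∏ⱼ (log vⱼ - log uⱼ)` is analytic on `Ω`; on `X`,
`Re g < π²` (the real-form slot contributes `-2i arg uᵢ`, `|arg uᵢ| < π/2`, the free slot a factor with `|Im| < π`); at
`P_χ`, `g = ∏ⱼ (2χ - 2i arg wⱼ)`, `Re g(P_χ) = 4χ² - 4 arg w₀ arg w₁ ≥ 4χ² - π² > π² + 1`; take `c = g(P_χ)`,
`U = {z ∈ Ω | Re g z < Re c}`, `f = (g - c)⁻¹`; if `G` on `E` agrees with `f` on `U ∩ E` then `(g - c) G - 1` is analytic on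
`E`, vanishes on the non-empty open `U ∩ E ⊇ X`, hence on `E` (identity theorem, `E` preconnected), contradicting its value
`-1` at `P_χ`.  Meaning: before positivity is used at complex points, the available data live on the cross `X`, whose
envelope of holomorphy excludes the large-boost orbit points; the Gram/Schwarz tower of OS II Ch. V is necessary. -/
theorem stub_twoSlotEnvelopeObstruction :
    ∀ (w : Fin 2 → ℂ), (∀ j, 0 < (w j).re) → ∀ χ : ℝ, 3 ≤ χ →
      ∃ (U : Set (Fin 2 → ℂ × ℂ)) (f : (Fin 2 → ℂ × ℂ) → ℂ), IsOpen U ∧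
        {z : Fin 2 → ℂ × ℂ | (∀ j, 0 < (z j).1.re ∧ 0 < (z j).2.re) ∧
          ∃ j, ∀ i, i ≠ j → (z i).2 = starRingEnd ℂ (z i).1} ⊆ U ∧
        U ⊆ {z : Fin 2 → ℂ × ℂ | ∀ j, 0 < (z j).1.re ∧ 0 < (z j).2.re} ∧
        DifferentiableOn ℂ f U ∧
        ∀ E : Set (Fin 2 → ℂ × ℂ), IsOpen E → IsPreconnected E →
          {z : Fin 2 → ℂ × ℂ | (∀ j, 0 < (z j).1.re ∧ 0 < (z j).2.re) ∧
            ∃ j, ∀ i, i ≠ j → (z i).2 = starRingEnd ℂ (z i).1} ⊆ E →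
          (fun j => (((Real.exp (-χ) : ℝ) : ℂ) * w j, ((Real.exp χ : ℝ) : ℂ) * starRingEnd ℂ (w j))) ∈ E →
          E ⊆ {z : Fin 2 → ℂ × ℂ | ∀ j, 0 < (z j).1.re ∧ 0 < (z j).2.re} →
          ∀ G : (Fin 2 → ℂ × ℂ) → ℂ, AnalyticOnNhd ℂ G E → Set.EqOn G f (U ∩ E) → False :=
  -- CLOSED (generation 11, wave 1): landed `Theorems/PencilRigidityNPointIsotropyTwoSlotEnvelopeObstruction.lean`
  Summit.QuantumFields.YangMills.Theorems.NPointIsotropy.ComplexRotationBandlimit.stub_twoSlotEnvelopeObstruction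

/-- **Degree 0 of the doubled orbit kernel** (lead c3, generation 9; landed as
`Theorems/PencilRigidityNPointIsotropyDoubledOrbitKernelDegZero.lean`, registered sub-goal `doubledOrbitKernel_degZero`; repeated
here so that this file elaborates before that file is built on the farm): in degree `0` the configuration space is a point,
`linActMulti R F = F`, time-ordering is vacuous, every witness of `ΘF* ⊗ F` is the same Schwartz map, and the kernel is the
constant `𝔖₀(ΘF* ⊗ F)` (type `N = 0`, margin `ε = 1`).  No hypothesis on `S₁`. -/
theorem doubledOrbitKernel_degZero' : ∀ (S₁ : Literature.MathematicalPhysics.QuantumLattice.SchwingerFamily (EuclideanSpace ℝ (Fin 4))), ∃ N : ℝ, ∀ (F : SchwartzMap (Fin 0 → EuclideanSpace ℝ (Fin 4)) ℂ), Literature.MathematicalPhysics.QuantumLattice.IsTimeOrdered F → HasCompactSupport (F : (Fin 0 → EuclideanSpace ℝ (Fin 4)) → ℂ) → ∃ ε : ℝ, 0 < ε ∧ (∀ η : ℝ, |η| < ε → Literature.MathematicalPhysics.QuantumLattice.IsTimeOrdered (Literature.MathematicalPhysics.QuantumLattice.linActMulti (Literature.MathematicalPhysics.QuantumFieldTheory.planeRot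 (0 : Fin 3) η) F)) ∧ ∃ (K : ℂ → ℂ → ℂ) (C : ℝ), DifferentiableOn ℂ (Function.uncurry K) ({z : ℂ | |z.re| < ε} ×ˢ {z : ℂ | |z.re| < ε}) ∧ (∀ θ : ℂ, |θ.re| < ε → ‖K (starRingEnd ℂ θ) θ‖ ≤ C * Real.exp (2 * N * |θ.im|)) ∧ ∀ η η' : ℝ, |η| < ε → |η'| < ε → ∀ H : SchwartzMap (Fin (0 + 0) → EuclideanSpace ℝ (Fin 4)) ℂ, Literature.MathematicalPhysics.QuantumLattice.IsAppendTensorOf H (Literature.MathematicalPhysics.QuantumLattice.osAdjoint (Literature.MathematicalPhysics.QuantumLattice.linActMulti (Literature.MathematicalPhysics.QuantumFieldTheory.planeRot (0 : Fin 3) η') F)) (Literature.MathematicalPhysics.QuantumLattice.linActMulti (Literature.MathematicalPhysics.QuantumFieldTheory.planeRot (0 : Fin 3) η) F) → K η' η = S₁ (0 + 0) H := by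
  intro S₁
  refine ⟨0, fun F _ _ => ?_⟩
  obtain ⟨H₀, hH₀⟩ := exists_isAppendTensorOf (osAdjoint F) F
  have hto : ∀ G : 𝓢((Fin 0 → E4), ℂ), IsTimeOrdered G := fun G _ _ => ⟨fun i => Fin.elim0 i, fun i => Fin.elim0 i⟩
  refine ⟨1, one_pos, fun η _ => hto _, fun _ _ => S₁ (0 + 0) H₀, ‖S₁ (0 + 0) H₀‖,
    differentiableOn_const _, fun θ _ => by simp, fun η η' _ _ H hH => ?_⟩
  have hη : linActMulti (planeRot (0 : Fin 3) η) F = F :=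
    Summit.QuantumFields.YangMills.Theorems.NPointIsotropy.ComplexRotationBandlimit.DegreeLeTwo.linActMulti_fin_zero _ F
  have hη' : linActMulti (planeRot (0 : Fin 3) η') F = F :=
    Summit.QuantumFields.YangMills.Theorems.NPointIsotropy.ComplexRotationBandlimit.DegreeLeTwo.linActMulti_fin_zero _ F
  have hHH : H = H₀ := by
    ext x
    rw [hH x, hH₀ x, hη, hη']
  rw [hHH]


/-! ## CLOSED stubs of this line (generations 2–6) and the sibling's landed levers (aliases; all sorry-free) -/

/-- **Stub 2 — the planar spectral cone (difficulty L; = the shared model-blind item stmt-QuantumFields-9664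
`MirrorModularBoosts.PlanarSpectralCone` VERBATIM, see `stub_planarCone_iff`; staffed on its own seat).** E0' + E3 +
translations + E2 in the eight planar frames ⇒ the planar cone `PlanarCone S₁` (joint holomorphy of
`(t,b) ↦ 𝔖(ΘF* ⊗ G_{(t e₀ + b e₁)})` on `{|Im b| < Re t}` with the contraction bound). Consumed by stubs 3 and 5. -/
theorem stub_planarCone :
    open Literature.MathematicalPhysics.QuantumLattice Literature.MathematicalPhysics.AQFT
      Summit.QuantumFields.YangMills.Theorems.CurvatureBoostCovariance.Negative
      Summit.QuantumFields.YangMills.Theorems.NPointIsotropy.Negative in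
    ∀ S₁ : SchwingerFamily E4, S₁.toLabelled.HasLinearGrowth → S₁.toLabelled.IsSymmetric →
      Translations S₁ → EightFrameRP S₁ → PlanarCone S₁ :=
  Summit.QuantumFields.YangMills.Cruxes.PlanarSpectralCone.PositivityDiscToOperatorCone.PlanarSpectralCone_of

/-- **Stub 4 — angular Paley–Wiener (CLOSED).** An entire `π/2`-periodic function with `‖Φ z‖ ≤ C e^{N|Im z|}` is a
trigonometric polynomial in `e^{4iθ}` of degree `≤ K` whenever `N < 4(K+1)`. LANDED by a stub worker of this line:
`Theorems/PencilRigidityNPointIsotropyBandlimit.lean` (p75205; rectangle contour shift + Fourier series on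
`AddCircle (π/2)`), imported here. -/
theorem stub_bandlimit :
    ∀ (Φ : ℂ → ℂ) (C N : ℝ) (K : ℕ), Differentiable ℂ Φ →
      (∀ z : ℂ, Φ (z + (Real.pi / 2 : ℝ)) = Φ z) →
      (∀ z : ℂ, ‖Φ z‖ ≤ C * Real.exp (N * |z.im|)) →
      N < 4 * ((K : ℝ) + 1) →
      ∃ c : ℤ → ℂ, ∀ θ : ℝ,
        Φ θ = ∑ k ∈ Finset.Icc (-(K : ℤ)) K, c k * Complex.exp (4 * (k : ℂ) * (θ : ℂ) * Complex.I) :=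
  Summit.QuantumFields.YangMills.Theorems.NPointIsotropy.ComplexRotationBandlimit.stub_bandlimit

/-- **Stub 6 — mop-up (CLOSED; model-blind given Step 0; difficulty M).** LANDED by a stub worker of this line: `Theorems/PencilRigidityNPointIsotropyMopupHelpers.lean` (p76690) + `Theorems/PencilRigidityNPointIsotropyMopup.lean` (p77623), imported here. If
every `𝔖ₙ|⁰𝒮` is integration against a function `Wₙ` and `S₁` is planar-invariant on generic compact supports, then
`S₁` is planar-invariant on all of `⁰𝒮`: every determinant-one isometry fixing `e₂, e₃` is `planeRot 0 θ`
(explicit 4×4 Laplace expansion of the determinant); `𝔖ₙ(R·F) = ∫ Wₙ·(R·F) = ∫ (Wₙ∘R)·F` (Lebesgue measure on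
`(ℝ⁴)ⁿ` is `R`-invariant; `R·F ∈ ⁰𝒮`); there is an OPEN set `G ⊆ (coincidence locus)ᶜ` with `volume Gᶜ = 0`
(complement = finite union of null quadrics `⟪π(xᵢ-xⱼ), π(x_k-x_l)⟫ = 0`, Fubini via `lmarginal`) on which every
supported test function is planar-generic; truncating `F` by a smooth exhaustion `χ_k ↑ 1_G` and dominated
convergence against the `L¹` density give `∫ (Wₙ∘R - Wₙ)·F = lim ∫ (Wₙ∘R - Wₙ)·(χ_k F) = 0`. No continuity, density
or du Bois-Reymond step is needed. False without Step 0 (`Negative.PlanarGenericJunk.planar_generic_not_determining`). -/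
theorem stub_mopup :
    open Literature.MathematicalPhysics.QuantumLattice Literature.MathematicalPhysics.AQFT
      Literature.MathematicalPhysics.QuantumFieldTheory
      Summit.QuantumFields.YangMills.Theorems.CurvatureBoostCovariance.Negative
      Summit.QuantumFields.YangMills.Theorems.NPointIsotropy.Negative in
    ∀ (S₁ : SchwingerFamily E4),
      (∀ n : ℕ, ∃ W : (Fin n → E4) → ℂ, ∀ F : SchwartzMap (Fin n → E4) ℂ, IsOffDiagonal F →
        MeasureTheory.Integrable (fun x : Fin n → E4 => W x * F x) ∧
          S₁ n F = ∫ x : Fin n → E4, W x * F x) →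
      (∀ (θ : ℝ) (n : ℕ) (F : SchwartzMap (Fin n → E4) ℂ), IsOffDiagonal F →
        HasCompactSupport (F : (Fin n → E4) → ℂ) →
        (∀ x ∈ tsupport (F : (Fin n → E4) → ℂ), ∀ φ : ℝ,
          (∀ i j : Fin n, i ≠ j → (planeRot (0 : Fin 3) φ (x i)) 0 ≠ (planeRot (0 : Fin 3) φ (x j)) 0) ∨
          (∀ i j : Fin n, i ≠ j → (planeRot (0 : Fin 3) φ (x i)) 1 ≠ (planeRot (0 : Fin 3) φ (x j)) 1)) →
        S₁ n (linActMulti (planeRot (0 : Fin 3) θ) F) = S₁ n F) →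
      PlanarInvariant S₁ :=
  Summit.QuantumFields.YangMills.Theorems.NPointIsotropy.ComplexRotationBandlimit.stub_mopup

/-- **Stub 4a-i — HOLOMORPHIC VECTORS FROM A SESQUI-HOLOMORPHIC GRAM KERNEL ON A STRIP (abstract Hilbert space; pure
complex analysis; model-blind; difficulty M; registered by the continuation lead c1 at reshape 6, 2026-08-16; PROVED by the
wave-1 worker and LANDED as `Theorems/MirrorModularBoostsCurvatureBoostCovarianceGramVecOnStrip.lean`, p97780).**
Let `Φ : ℝ → H` be vectors attached to the real points of the strip `{|Re z| < ε}` and `K` a function of two complex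
variables, jointly holomorphic on the square of the strip, with `⟪Φ η', Φ η⟫ = K(η', η)` at real points `|η|, |η'| < ε`.
Then there is `Ψ : ℂ → H`, holomorphic on the strip, equal to `Φ` at the real points, with `⟪Ψ w, Ψ z⟫ = K(w̄, z)` on the
whole strip (so `‖Ψ z‖² = Re K(z̄, z)`).  This is the tree's `exists_holomorphic_gramVec`
(`Literature/MathematicalPhysics/QuantumFieldTheory/OSHolomorphicVectors.lean`, OS II Ch. V.2 (5.16)–(5.21) in abstract
form: real-centred polydiscs) transported through the biholomorphism `z ↦ tan(π z / (4ε))` of the strip onto the unit disc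
(a real-centred disc; it maps the real segment `(-ε, ε)` onto the diameter `(-1, 1)` and commutes with complex conjugation;
inverse `u ↦ (4ε/π) · (2i)⁻¹ log((1 + iu)/(1 - iu))`, `Re (1+iu)/(1-iu) = (1 - |u|²)/|1 - iu|² > 0` on the disc). -/
theorem stub_gramVecOnStrip :
    ∀ (H : Type) [NormedAddCommGroup H] [InnerProductSpace ℂ H] [CompleteSpace H] (ε : ℝ), 0 < ε →
      ∀ (Φ : ℝ → H) (K : ℂ → ℂ → ℂ),
        DifferentiableOn ℂ (Function.uncurry K) ({z : ℂ | |z.re| < ε} ×ˢ {z : ℂ | |z.re| < ε}) →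
        (∀ η η' : ℝ, |η| < ε → |η'| < ε → ⟪Φ η', Φ η⟫_ℂ = K η' η) →
        ∃ Ψ : ℂ → H, DifferentiableOn ℂ Ψ {z : ℂ | |z.re| < ε} ∧
          (∀ η : ℝ, |η| < ε → Ψ η = Φ η) ∧
          ∀ w z : ℂ, |w.re| < ε → |z.re| < ε → ⟪Ψ w, Ψ z⟫_ℂ = K (starRingEnd ℂ w) z :=
  Summit.QuantumFields.YangMills.Theorems.CurvatureBoostCovariance.BoostsInheritMirrors.stub_gramVecOnStrip

/-- **Stub 3 — doubled orbit functions are trigonometric polynomials (model-blind analysis; difficulty XL as filed; RESHAPED by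
the lead at reshape 3, 2026-08-16: the analytic input Stub 4a (uniform planar boost vectors) is the explicit first hypothesis,
and with it the stub is PROVED — wave-2 worker's 1443-line reduction, landing in five files via Stubs 3a–3d).**  For a
one-species family with the OS package (E0' temperedness, E3 symmetry, …), translation and proper hypercubic
invariance on `⁰𝒮`, E2 in the eight planar frames, the planar cone and the Step-0 function residual, for all
compactly supported `e₀`-time-ordered `F` (degree `n`), `G` (degree `m`) and every witness `H` of `ΘF* ⊗ G`, the orbit
function `θ ↦ 𝔖_{n+m}(planeRot 0 θ · H)` is a trigonometric polynomial `Σ_{|k|≤K} c_k e^{4ikθ}` (some `K`, `c`; NO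
uniformity of the degree in `F, G` is asked — the composition does not need it; the expected proof gives
`K = ⌊N(S₁,n+m)/4⌋` anyway).
Mechanism (card (iii) "caps", in the shape all three NPointIsotropy triagers passed): complexify the angle; for
`θ + iχ` the consecutive differences of `R_{θ+iχ}x` lie in the `e₀`-planar tube `{|Im Δζ¹| < Re Δζ⁰}` iff
`Δ(R_θ x)⁰ > 0`, for EVERY real `χ` (`cosh χ > |sinh χ|`), likewise in the `e₁`-frame (quarter turn ∈ `Hypercubic`);
on planar-generic compact supports the strips glue to an ENTIRE `π/2`-periodic function of exponential type
`N(S₁, n+m)` (tempered growth of the multi-slot continuation — OS II without rotations, cone in multi-slot form via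
`OSReconstructionNoE1`), hence a trig polynomial of degree `⌊N/4⌋` by the LANDED Paley–Wiener lemma
`Theorems/PencilRigidityNPointIsotropyBandlimit.lean` (`ComplexRotationBandlimit.stub_bandlimit`); the function
residual upgrades "generic compact supports" to all compactly supported off-diagonal `H` (isotypic decomposition of
`Wₙ` a.e.; closed graph gives the local `L¹` control of `Wₙ` against rotation-swept flat envelopes), in particular to
doubled supports, which need not be planar-generic from degree `2 + 2` on.  Why the residual is a hypothesis: for ALL
off-diagonal `F` and no residual the band limit is FALSE (`NPointIsotropy.Negative.Triage3.not_AngularBandLimit`, the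
junk family).  Consistent with every controlled scheme (`Wₙ ∈ {0, κⁿ}`: constant orbit functions, `K = 0`). -/
theorem stub_orbitBandlimit :
    open Literature.MathematicalPhysics.QuantumLattice Literature.MathematicalPhysics.AQFT
      Literature.MathematicalPhysics.QuantumFieldTheory
      Summit.QuantumFields.YangMills.Theorems.CurvatureBoostCovariance.Negative
      Summit.QuantumFields.YangMills.Theorems.NPointIsotropy.Negative in
    (∀ (S₁ : SchwingerFamily E4) (h : OSReconstructionNoE1 S₁.toLabelled),
      S₁.toLabelled.HasLinearGrowth → S₁.toLabelled.IsSymmetric → EightFrameRP S₁ → PlanarCone S₁ →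
      ∀ (n : ℕ), ∃ N : ℝ, ∀ (F : SchwartzMap (Fin n → E4) ℂ), IsTimeOrdered F →
        HasCompactSupport (F : (Fin n → E4) → ℂ) →
        ∃ ε : ℝ, 0 < ε ∧ ∃ (V : ℂ → h.Hilbert) (C : ℝ),
          DifferentiableOn ℂ V {θ : ℂ | |θ.re| < ε} ∧
          (∀ θ : ℂ, |θ.re| < ε → ‖V θ‖ ≤ C * Real.exp (N * |θ.im|)) ∧
          ∀ θ : ℝ, |θ| < ε → ∀ hθ : IsTimeOrdered (linActMulti (planeRot (0 : Fin 3) θ) F),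
            V θ = h.fieldVec n (fun _ => ()) (linActMulti (planeRot (0 : Fin 3) θ) F) hθ) →
    ∀ (S₁ : SchwingerFamily E4), OSPackage S₁ → Translations S₁ → Hypercubic S₁ → EightFrameRP S₁ →
      PlanarCone S₁ → NPointRegular S₁ →
      ∀ (n m : ℕ) (F : SchwartzMap (Fin n → E4) ℂ) (G : SchwartzMap (Fin m → E4) ℂ),
        IsTimeOrdered F → IsTimeOrdered G →
        HasCompactSupport (F : (Fin n → E4) → ℂ) → HasCompactSupport (G : (Fin m → E4) → ℂ) →
        ∀ H : SchwartzMap (Fin (n + m) → E4) ℂ, IsAppendTensorOf H (osAdjoint F) G →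
          ∃ (K : ℕ) (c : ℤ → ℂ), ∀ θ : ℝ,
            S₁ (n + m) (linActMulti (planeRot (0 : Fin 3) θ) H) =
              ∑ k ∈ Finset.Icc (-(K : ℤ)) K, c k * Complex.exp (4 * (k : ℂ) * (θ : ℂ) * Complex.I) :=
  Summit.QuantumFields.YangMills.Theorems.CurvatureBoostCovariance.BoostsInheritMirrors.stub_orbitBandlimit

/-- **Stub 4 — BOOSTS INHERIT THE MIRRORS: ray positivity of the doubled pencils (THE LEVER (i); model-blind;
difficulty L–XL; RESHAPED by the lead 2026-08-16: the analytic input Stub 4a is the explicit first hypothesis, and with it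
the stub is PROVED — wave-1 worker's reduction, landing in two files via Stub 4b).**  For a one-species family with the OS package, translations, E2 in the eight planar frames, the
planar cone of `S₁` AND the planar-cone theorem for eight-frame families (stub 2, for the 45° pull-backs), for
compactly supported `e₀`-time-ordered `F` (degree `n`) and `G` (degree `m`) with witnesses of the four doubled blocks
`ΘF*⊗F, ΘF*⊗G, ΘG*⊗F, ΘG*⊗G` whose orbit functions are trigonometric polynomials with coefficients `p, q, q', r`:
for every real `s ≠ 0` the 2×2 pencil `[[P(s), Q(s)], [Q'(s), R(s)]]` is positive semidefinite
(`v̄v P(s) + v̄w Q(s) + w̄v Q'(s) + w̄w R(s) ≥ 0`, real, for all `v, w ∈ ℂ`).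
Mechanism (card (i), re-derived by all three triagers): `s = e^{-4χ} > 0` is the entire pencil at the angle `iχ`;
for `|θ| < ε` (margin from the compact supports in the open ordered chambers) and all real `χ` the configuration
`R_{θ+iχ}·supp H` lies in the `e₀`-planar tube, where the multi-slot continuation of `𝔖_{n+m}` is holomorphic and,
at `θ = 0`, equals the Gram form `⟨Ψ^χ_F, Ψ^χ_G⟩` of `Ψ^χ_F := ∫F(x) ∏_j e^{-Δτ_j H_χ + iΔσ_j P_χ + iΔx⊥·P⊥} φ Ω`
(`-τH_χ + iσP_χ = -ζH + iβP₁` with `(ζ,β) = R_{iχ}(τ,σ)`; `ΘR_{iχ} = R_{-iχ}Θ` matches the bra; `H_χ ≥ e^{-|χ|}H ≥ 0`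
and `[H_χ, P_χ] = 0` by the cone, so the products are contractions for every real `χ`); identity theorem on the
strip `(-ε,ε) × iℝ` identifies it with the trig polynomial; Gram matrices are PSD.  `s = -e^{-4χ} < 0` is the angle
`π/4 + iχ`: `𝔖(R_{π/4}R_{θ'}·H)` is the orbit function of `H` under the pull-back `T = 𝔖 ∘ (R_{π/4}·)`, which is
`e₀`-RP (`EightFrameRP` at the frame `R_{π/4}`, time axis `(e₀ - e₁)/√2`) and has the `e₀`-cone by stub 2 (its E0',
E3, translations and eight frames are transported from `S₁`), so the same Gram argument applies to `T`.
No genericity and no gluing across frames is needed here (only the strip at `θ = 0`, resp. `θ = π/4`). -/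
theorem stub_rayPositivity :
    open Literature.MathematicalPhysics.QuantumLattice Literature.MathematicalPhysics.AQFT
      Literature.MathematicalPhysics.QuantumFieldTheory
      Summit.QuantumFields.YangMills.Theorems.CurvatureBoostCovariance.Negative
      Summit.QuantumFields.YangMills.Theorems.NPointIsotropy.Negative in
    (∀ (S₁ : SchwingerFamily E4) (h : OSReconstructionNoE1 S₁.toLabelled),
      S₁.toLabelled.HasLinearGrowth → S₁.toLabelled.IsSymmetric → EightFrameRP S₁ → PlanarCone S₁ →
      ∀ (n : ℕ) (F : SchwartzMap (Fin n → E4) ℂ), IsTimeOrdered F →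
        HasCompactSupport (F : (Fin n → E4) → ℂ) →
        ∃ ε : ℝ, 0 < ε ∧ ∃ (V : ℂ → h.Hilbert) (C N : ℝ),
          DifferentiableOn ℂ V {θ : ℂ | |θ.re| < ε} ∧
          (∀ θ : ℂ, |θ.re| < ε → ‖V θ‖ ≤ C * Real.exp (N * |θ.im|)) ∧
          ∀ θ : ℝ, |θ| < ε → ∀ hθ : IsTimeOrdered (linActMulti (planeRot (0 : Fin 3) θ) F),
            V θ = h.fieldVec n (fun _ => ()) (linActMulti (planeRot (0 : Fin 3) θ) F) hθ) →
    ∀ (S₁ : SchwingerFamily E4), OSPackage S₁ → Translations S₁ → EightFrameRP S₁ → PlanarCone S₁ →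
      Summit.QuantumFields.YangMills.Theses.MirrorModularBoosts.PlanarSpectralCone →
      ∀ (n m : ℕ) (F : SchwartzMap (Fin n → E4) ℂ) (G : SchwartzMap (Fin m → E4) ℂ),
        IsTimeOrdered F → IsTimeOrdered G →
        HasCompactSupport (F : (Fin n → E4) → ℂ) → HasCompactSupport (G : (Fin m → E4) → ℂ) →
        ∀ (HFF : SchwartzMap (Fin (n + n) → E4) ℂ) (HFG : SchwartzMap (Fin (n + m) → E4) ℂ)
          (HGF : SchwartzMap (Fin (m + n) → E4) ℂ) (HGG : SchwartzMap (Fin (m + m) → E4) ℂ),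
          IsAppendTensorOf HFF (osAdjoint F) F → IsAppendTensorOf HFG (osAdjoint F) G →
          IsAppendTensorOf HGF (osAdjoint G) F → IsAppendTensorOf HGG (osAdjoint G) G →
        ∀ (Kp Kq Kq' Kr : ℕ) (p q q' r : ℤ → ℂ),
          (∀ θ : ℝ, S₁ (n + n) (linActMulti (planeRot (0 : Fin 3) θ) HFF) =
            ∑ k ∈ Finset.Icc (-(Kp : ℤ)) Kp, p k * Complex.exp (4 * (k : ℂ) * (θ : ℂ) * Complex.I)) →
          (∀ θ : ℝ, S₁ (n + m) (linActMulti (planeRot (0 : Fin 3) θ) HFG) =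
            ∑ k ∈ Finset.Icc (-(Kq : ℤ)) Kq, q k * Complex.exp (4 * (k : ℂ) * (θ : ℂ) * Complex.I)) →
          (∀ θ : ℝ, S₁ (m + n) (linActMulti (planeRot (0 : Fin 3) θ) HGF) =
            ∑ k ∈ Finset.Icc (-(Kq' : ℤ)) Kq', q' k * Complex.exp (4 * (k : ℂ) * (θ : ℂ) * Complex.I)) →
          (∀ θ : ℝ, S₁ (m + m) (linActMulti (planeRot (0 : Fin 3) θ) HGG) =
            ∑ k ∈ Finset.Icc (-(Kr : ℤ)) Kr, r k * Complex.exp (4 * (k : ℂ) * (θ : ℂ) * Complex.I)) →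
        ∀ s : ℝ, s ≠ 0 → ∀ v w : ℂ,
          (fun z : ℂ => 0 ≤ z.re ∧ z.im = 0)
            ((∑ k ∈ Finset.Icc (-(Kp : ℤ)) Kp, starRingEnd ℂ v * v * (p k * (s : ℂ) ^ k)) +
            (∑ k ∈ Finset.Icc (-(Kq : ℤ)) Kq, starRingEnd ℂ v * w * (q k * (s : ℂ) ^ k)) +
            (∑ k ∈ Finset.Icc (-(Kq' : ℤ)) Kq', starRingEnd ℂ w * v * (q' k * (s : ℂ) ^ k)) +
            (∑ k ∈ Finset.Icc (-(Kr : ℤ)) Kr, starRingEnd ℂ w * w * (r k * (s : ℂ) ^ k))) :=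
  Summit.QuantumFields.YangMills.Theorems.CurvatureBoostCovariance.BoostsInheritMirrors.stub_rayPositivity

/-- **Stub 6a — TENSOR DENSITY (du Bois-Reymond for appended tensor products; pure analysis, model-blind;
difficulty M; provable now; added by the lead at reshape 1, 2026-08-16).**  Let `U ⊆ (ℝ⁴)ⁿ`, `V ⊆ (ℝ⁴)ᵐ` be open and
`D` locally integrable on the appended product set `U ×' V = {x | (xᵢ)_{i<n} ∈ U ∧ (x_{n+j})_{j<m} ∈ V}`.  If
`∫ D · H = 0` for every appended tensor product `H = Φ ⊗ Ψ` (`IsAppendTensorOf`) of Schwartz functions `Φ`, `Ψ` with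
compact supports inside `U`, `V`, then `∫ D · K = 0` for EVERY Schwartz `K` with compact support inside `U ×' V`
(equivalently `D = 0` a.e. on `U ×' V`).  Proof on offer: Stone–Weierstrass on a compact product neighbourhood
`K₁ ×' L₁` of `tsupport K` (the *-algebra generated by restrictions of tensors `Φ ⊗ Ψ` of compactly supported
smooth functions separates points — `ContDiffBump`s — hence is dense in `C(K₁ ×' L₁, ℂ)`,
`ContinuousMap.starSubalgebra_topologicalClosure_eq_top_of_separatesPoints`); multiply the approximants by a fixed
cut-off tensor `χ_U ⊗ χ_V ≡ 1` on `tsupport K` (products of tensors are tensors, so each approximant is a finite sum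
of admissible `H`'s, killed by hypothesis) and pass to the limit by dominated convergence (`D` integrable on
`K₁ ×' L₁`).  Alternative: Fubini + the one-factor du Bois-Reymond lemma
`IsOpen.ae_eq_zero_of_integral_contDiff_smul_eq_zero` twice with a countable dense family.  This is the density step
of Stub 6 isolated as its own registered stub (the lead's reshape: Stub 6 consumes it as an explicit hypothesis). -/
theorem stub_tensorDensity :
    open Literature.MathematicalPhysics.QuantumLattice Literature.MathematicalPhysics.AQFT
      Literature.MathematicalPhysics.QuantumFieldTheory
      Summit.QuantumFields.YangMills.Theorems.CurvatureBoostCovariance.Negative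
      Summit.QuantumFields.YangMills.Theorems.NPointIsotropy.Negative in
    ∀ (n m : ℕ) (U : Set (Fin n → E4)) (V : Set (Fin m → E4)), IsOpen U → IsOpen V →
      ∀ D : (Fin (n + m) → E4) → ℂ,
        MeasureTheory.LocallyIntegrableOn D
          {x | (fun i => x (Fin.castAdd m i)) ∈ U ∧ (fun j => x (Fin.natAdd n j)) ∈ V} →
        (∀ (Φ : SchwartzMap (Fin n → E4) ℂ) (Ψ : SchwartzMap (Fin m → E4) ℂ),
          HasCompactSupport (Φ : (Fin n → E4) → ℂ) → tsupport (Φ : (Fin n → E4) → ℂ) ⊆ U →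
          HasCompactSupport (Ψ : (Fin m → E4) → ℂ) → tsupport (Ψ : (Fin m → E4) → ℂ) ⊆ V →
          ∀ H : SchwartzMap (Fin (n + m) → E4) ℂ, IsAppendTensorOf H Φ Ψ →
            ∫ x : Fin (n + m) → E4, D x * H x = 0) →
        ∀ K : SchwartzMap (Fin (n + m) → E4) ℂ, HasCompactSupport (K : (Fin (n + m) → E4) → ℂ) →
          tsupport (K : (Fin (n + m) → E4) → ℂ) ⊆
            {x | (fun i => x (Fin.castAdd m i)) ∈ U ∧ (fun j => x (Fin.natAdd n j)) ∈ V} →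
          ∫ x : Fin (n + m) → E4, D x * K x = 0 :=
  Summit.QuantumFields.YangMills.Theorems.CurvatureBoostCovariance.BoostsInheritMirrors.stub_tensorDensity

/-- **Stub 6 — from doubled orbits to `⁰𝒮` (model-blind given Step 0; difficulty M–L; provable now; RESHAPED by the
lead 2026-08-16: the tensor-density step is the explicit first hypothesis, discharged by Stub 6a in the composition).**  If every
`𝔖_N|⁰𝒮` is integration against a function `W_N` (Step 0), `S₁` is translation invariant on `⁰𝒮` and E3-symmetric
(inside `OSPackage`), and the orbit functions of ALL doubled test functions `ΘF* ⊗ G` with `deg F, deg G ≤ b`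
(compact supports) are constant, then `S₁` is planar-invariant on `⁰𝒮` in every degree `N ≤ 2b`, under every
determinant-one isometry fixing `e₂, e₃` (verbatim the clause of `PlanarInvariant`).  Proof: such an `R` is
`planeRot 0 φ` (landed `PencilRigidityNPointIsotropyMopupHelpers`, `Mopup.exists_eq_planeRot`); for `N ≤ 2b` take the
balanced cut `N = n + m`, `n, m ≤ b`; the witnesses of `ΘF* ⊗ G` over compactly supported time-ordered `F, G` contain
all products `φ ⊗ ψ`, `φ ∈ C_c^∞` (negative ordered chamber), `ψ ∈ C_c^∞` (positive ordered chamber), which determine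
`L¹_loc` functions on the product chamber (Fubini + a countable dense family), so `D_φ := W_N ∘ R_φ - W_N = 0` a.e. on
the cut chamber; E3 (label permutations commute with the diagonal action) and translation invariance (`W_N(· + c) =
W_N` a.e. for each `c`; rational time-shifts suffice since chambers are open) spread this to the open conull set
`{x : x_i⁰ pairwise distinct}`; conclude with the landed a.e. change of variables
`Mopup.apply_linActMulti_eq_of_generic` (`PencilRigidityNPointIsotropyMopup.lean`).  No density in `𝒮`, no continuity
across the exceptional set; false without the residual (`NPointIsotropy.Negative.PlanarGenericJunk`). -/
theorem stub_doubledToInvariant :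
    open Literature.MathematicalPhysics.QuantumLattice Literature.MathematicalPhysics.AQFT
      Literature.MathematicalPhysics.QuantumFieldTheory
      Summit.QuantumFields.YangMills.Theorems.CurvatureBoostCovariance.Negative
      Summit.QuantumFields.YangMills.Theorems.NPointIsotropy.Negative in
    (∀ (n m : ℕ) (U : Set (Fin n → E4)) (V : Set (Fin m → E4)), IsOpen U → IsOpen V →
      ∀ D : (Fin (n + m) → E4) → ℂ,
        MeasureTheory.LocallyIntegrableOn D
          {x | (fun i => x (Fin.castAdd m i)) ∈ U ∧ (fun j => x (Fin.natAdd n j)) ∈ V} →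
        (∀ (Φ : SchwartzMap (Fin n → E4) ℂ) (Ψ : SchwartzMap (Fin m → E4) ℂ),
          HasCompactSupport (Φ : (Fin n → E4) → ℂ) → tsupport (Φ : (Fin n → E4) → ℂ) ⊆ U →
          HasCompactSupport (Ψ : (Fin m → E4) → ℂ) → tsupport (Ψ : (Fin m → E4) → ℂ) ⊆ V →
          ∀ H : SchwartzMap (Fin (n + m) → E4) ℂ, IsAppendTensorOf H Φ Ψ →
            ∫ x : Fin (n + m) → E4, D x * H x = 0) →
        ∀ K : SchwartzMap (Fin (n + m) → E4) ℂ, HasCompactSupport (K : (Fin (n + m) → E4) → ℂ) →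
          tsupport (K : (Fin (n + m) → E4) → ℂ) ⊆
            {x | (fun i => x (Fin.castAdd m i)) ∈ U ∧ (fun j => x (Fin.natAdd n j)) ∈ V} →
          ∫ x : Fin (n + m) → E4, D x * K x = 0) →
    ∀ (S₁ : SchwingerFamily E4), OSPackage S₁ → Translations S₁ → NPointRegular S₁ →
      ∀ b : ℕ,
        (∀ n m : ℕ, n ≤ b → m ≤ b →
          ∀ (F : SchwartzMap (Fin n → E4) ℂ) (G : SchwartzMap (Fin m → E4) ℂ),
            IsTimeOrdered F → IsTimeOrdered G →
            HasCompactSupport (F : (Fin n → E4) → ℂ) → HasCompactSupport (G : (Fin m → E4) → ℂ) →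
            ∀ H : SchwartzMap (Fin (n + m) → E4) ℂ, IsAppendTensorOf H (osAdjoint F) G →
              ∀ θ : ℝ, S₁ (n + m) (linActMulti (planeRot (0 : Fin 3) θ) H) = S₁ (n + m) H) →
        ∀ N : ℕ, N ≤ 2 * b → ∀ R : E4 ≃ₗᵢ[ℝ] E4,
          LinearMap.det (R.toLinearEquiv : E4 →ₗ[ℝ] E4) = 1 →
          R (EuclideanSpace.single 2 1) = EuclideanSpace.single 2 1 →
          R (EuclideanSpace.single 3 1) = EuclideanSpace.single 3 1 →
          ∀ F : SchwartzMap (Fin N → E4) ℂ, IsOffDiagonal F → S₁ N (linActMulti R F) = S₁ N F :=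
  Summit.QuantumFields.YangMills.Theorems.CurvatureBoostCovariance.BoostsInheritMirrors.stub_doubledToInvariant

/-- **THE PARITY SIEVE (the lever (ii); PROVED, landed).**  A 2×2 Laurent pencil `[[P,Q],[Q',R]](s)` that is positive
semidefinite for EVERY real `s ≠ 0` and whose diagonal entries have no layer `|k| ≥ 2` has constant off-diagonal entry. -/
theorem stub_paritySieve :
    ∀ (Kp Kq Kq' Kr : ℕ) (p q q' r : ℤ → ℂ),
      (∀ s : ℝ, s ≠ 0 → ∀ v w : ℂ,
        (fun z : ℂ => 0 ≤ z.re ∧ z.im = 0)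
          ((∑ k ∈ Finset.Icc (-(Kp : ℤ)) Kp, starRingEnd ℂ v * v * (p k * (s : ℂ) ^ k)) +
          (∑ k ∈ Finset.Icc (-(Kq : ℤ)) Kq, starRingEnd ℂ v * w * (q k * (s : ℂ) ^ k)) +
          (∑ k ∈ Finset.Icc (-(Kq' : ℤ)) Kq', starRingEnd ℂ w * v * (q' k * (s : ℂ) ^ k)) +
          (∑ k ∈ Finset.Icc (-(Kr : ℤ)) Kr, starRingEnd ℂ w * w * (r k * (s : ℂ) ^ k)))) →
      (∀ k ∈ Finset.Icc (-(Kp : ℤ)) Kp, 2 ≤ |k| → p k = 0) →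
      (∀ k ∈ Finset.Icc (-(Kr : ℤ)) Kr, 2 ≤ |k| → r k = 0) →
      ∀ k ∈ Finset.Icc (-(Kq : ℤ)) Kq, k ≠ 0 → q k = 0 :=
  Summit.QuantumFields.YangMills.Theorems.CurvatureBoostCovariance.BoostsInheritMirrors.stub_paritySieve


/-! ## Generation 5: the one-point theorem THROUGH THE TIE (three helper stubs, all CLOSED by wave 1 of lead c1) -/

/-- **Helper stub `riemannSumBox` (CLOSED, p99058; registered sub-goal).** Riemann sums of a Schwartz function over the
exploding fine boxes of a scheme converge to its Lebesgue integral. LANDED: `Theorems/PencilRigidityNPointIsotropyRiemannSum.lean`. -/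
theorem stub_riemannSumBox :
    ∀ (g : SchwartzMap (EuclideanSpace ℝ (Fin 4)) ℝ) (a : ℕ → ℝ) (L : ℕ → ℕ), (∀ k, 0 < a k) → Filter.Tendsto a Filter.atTop (nhds 0) → Filter.Tendsto (fun k => a k * L k) Filter.atTop Filter.atTop → Filter.Tendsto (fun k => a k ^ 4 * ∑ y ∈ Literature.Probability.LatticeModels.box 4 (L k), g (a k • Literature.MathematicalPhysics.QuantumLattice.siteToE y)) Filter.atTop (nhds (∫ x, g x)) :=
  Summit.QuantumFields.YangMills.Theorems.NPointIsotropy.ComplexRotationBandlimit.riemannSumBox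

/-- **Helper stub `latticeOnePointFactor` (CLOSED, p97089; registered sub-goal).** The exact lattice one-point formula of the
curvature channel at a scheme step (translation invariance of the torus Wilson state at EVERY real coupling).
LANDED: `Theorems/PencilRigidityNPointIsotropyLatticeOnePoint.lean`. -/
theorem stub_latticeOnePointFactor :
    ∀ (G : Type) [Group G] [TopologicalSpace G] [IsTopologicalGroup G] [CompactSpace G] [MeasurableSpace G] [BorelSpace G] (r : Literature.MathematicalPhysics.QuantumFieldTheory.LatticeRep G) (sch : Literature.MathematicalPhysics.QuantumFieldTheory.SpeciesScheme (Literature.MathematicalPhysics.QuantumFieldTheory.YMSpecies G)) (k : ℕ), ∃ μ : ℝ, ∀ g : SchwartzMap (EuclideanSpace ℝ (Fin 4)) ℝ, Literature.MathematicalPhysics.QuantumFieldTheory.latticeSchwinger r.ρ sch (fun s => s.F) k 1 (fun _ => r.curvature) (fun _ => g) = sch.c r.curvature k * (μ - sch.m r.curvature k) * (sch.a k ^ 4 * ∑ y ∈ Literature.Probability.LatticeModels.box 4 (sch.L k), g (sch.a k • Literature.MathematicalPhysics.QuantumLattice.siteToE y)) :=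
  Summit.QuantumFields.YangMills.Theorems.NPointIsotropy.ComplexRotationBandlimit.latticeOnePointFactor

/-- **Helper stub `onePointConst` (CLOSED, p97834; registered sub-goal).** Riemann sums + one-point factorisation + the tie at
order 1 ⇒ the one-point distribution of a tied family is `κ · dx` on all of `𝓢`. LANDED: `Theorems/PencilRigidityNPointIsotropyOnePoint.lean`. -/
theorem stub_onePointConst :
    (∀ (g : SchwartzMap (EuclideanSpace ℝ (Fin 4)) ℝ) (a : ℕ → ℝ) (L : ℕ → ℕ), (∀ k, 0 < a k) → Filter.Tendsto a Filter.atTop (nhds 0) → Filter.Tendsto (fun k => a k * L k) Filter.atTop Filter.atTop → Filter.Tendsto (fun k => a k ^ 4 * ∑ y ∈ Literature.Probability.LatticeModels.box 4 (L k), g (a k • Literature.MathematicalPhysics.QuantumLattice.siteToE y)) Filter.atTop (nhds (∫ x, g x))) → ∀ (G : Type) [Group G] [TopologicalSpace G] [IsTopologicalGroup G] [CompactSpace G] [MeasurableSpace G] [BorelSpace G] (r : Literature.MathematicalPhysics.QuantumFieldTheory.LatticeRep G) (sch : Literature.MathematicalPhysics.QuantumFieldTheory.SpeciesScheme (Literature.MathematicalPhysics.QuantumFieldTheory.YMSpecies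 G)) (S₁ : Literature.MathematicalPhysics.QuantumLattice.SchwingerFamily (EuclideanSpace ℝ (Fin 4))), (∀ k : ℕ, ∃ μ : ℝ, ∀ g : SchwartzMap (EuclideanSpace ℝ (Fin 4)) ℝ, Literature.MathematicalPhysics.QuantumFieldTheory.latticeSchwinger r.ρ sch (fun s => s.F) k 1 (fun _ => r.curvature) (fun _ => g) = sch.c r.curvature k * (μ - sch.m r.curvature k) * (sch.a k ^ 4 * ∑ y ∈ Literature.Probability.LatticeModels.box 4 (sch.L k), g (sch.a k • Literature.MathematicalPhysics.QuantumLattice.siteToE y))) → Summit.QuantumFields.YangMills.Theorems.CurvatureBoostCovariance.Negative.Tie r sch S₁ → ∃ κ : ℂ, ∀ F : SchwartzMap (Fin 1 → EuclideanSpace ℝ (Fin 4)) ℂ, S₁ 1 F = κ * ∫ x, F x :=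
  Summit.QuantumFields.YangMills.Theorems.NPointIsotropy.ComplexRotationBandlimit.onePointConst

section OnePoint

variable {G : Type} [Group G] [TopologicalSpace G] [IsTopologicalGroup G] [CompactSpace G]
  [MeasurableSpace G] [BorelSpace G]

/-- **The one-point distribution of a TIED family is `κ · dx`** — for every `G`, `r`, `sch` (any `β_k, c_k, m_k, a_k, L_k`) and
every `S₁` tied to the curvature channel along `sch`: `S₁ 1 F = κ ∫ F` on ALL of `𝓢((Fin 1 → ℝ⁴), ℂ)` (degree 1 is all
off-diagonal). The tie at order 1 is the ONLY hypothesis: `κ = lim_k c_k (μ_k − m_k)` exists because the tie demands a limit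
on one normalised bump, and then every other test function follows by the Riemann sums. -/
theorem onePoint_of_tie (r : LatticeRep G) (sch : SpeciesScheme (YMSpecies G)) (S₁ : SchwingerFamily E4)
    (htie : Tie r sch S₁) : ∃ κ : ℂ, ∀ F : 𝓢((Fin 1 → E4), ℂ), S₁ 1 F = κ * ∫ x, F x :=
  stub_onePointConst stub_riemannSumBox G r sch S₁ (fun k => stub_latticeOnePointFactor G r sch k) htie

/-- **Degree 1 of the crux's conclusion, unconditionally and for EVERY linear isometry of `ℝ⁴`, on all of `𝓢`** — from the
tie alone (Lebesgue measure on `Fin 1 → ℝ⁴` is invariant under `x ↦ (R⁻¹ xᵢ)ᵢ`). -/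
theorem degreeOne_invariant_of_tie (r : LatticeRep G) (sch : SpeciesScheme (YMSpecies G)) (S₁ : SchwingerFamily E4)
    (htie : Tie r sch S₁) (R : E4 ≃ₗᵢ[ℝ] E4) (F : 𝓢((Fin 1 → E4), ℂ)) : S₁ 1 (linActMulti R F) = S₁ 1 F := by
  obtain ⟨κ, hκ⟩ := onePoint_of_tie r sch S₁ htie
  rw [hκ, hκ]
  congr 1
  have hpt : ∀ x : Fin 1 → E4, (linActMulti R F) x = F (fun i => R.symm (x i)) := fun x => by
    rw [linActMulti_apply]
  simp_rw [hpt]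
  exact Summit.QuantumFields.YangMills.Theorems.NPointIsotropy.ComplexRotationBandlimit.DegreeLeTwo.integral_comp_isometry_pi
    1 R (F : (Fin 1 → E4) → ℂ)

/-- The function residual in degree 1 from the tie: `W₁ ≡ κ`. -/
theorem residual_one_of_tie (r : LatticeRep G) (sch : SpeciesScheme (YMSpecies G)) (S₁ : SchwingerFamily E4)
    (htie : Tie r sch S₁) :
    ∃ W : (Fin 1 → E4) → ℂ, ∀ F : 𝓢((Fin 1 → E4), ℂ), IsOffDiagonal F →
      Integrable (fun x : Fin 1 → E4 => W x * F x) ∧ S₁ 1 F = ∫ x : Fin 1 → E4, W x * F x := by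
  obtain ⟨κ, hκ⟩ := onePoint_of_tie r sch S₁ htie
  haveI : (volume : Measure (Fin 1 → E4)).HasTemperateGrowth := Measure.IsAddHaarMeasure.instHasTemperateGrowth
  refine ⟨fun _ => κ, fun F _ => ⟨(F.integrable (μ := volume)).const_mul κ, ?_⟩⟩
  rw [hκ F, integral_const_mul]

/-- **The `β_k = 0`-frequently slice of scheme space is CLOSED** (Disproof §5 `conclusion_on_tensors_of_beta_zero` with its
hypothesis `h1` discharged by `degreeOne_invariant_of_tie`): a family tied to such a scheme is invariant on off-diagonal real
tensors of positive degree under EVERY linear isometry of `ℝ⁴` — whatever `c_k, m_k, a_k, L_k` and the faithful `r`. -/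
theorem conclusion_on_tensors_of_beta_zero (r : LatticeRep G) (sch : SpeciesScheme (YMSpecies G))
    (hβ : ∃ᶠ k in atTop, sch.β k = 0) {S₁ : SchwingerFamily E4} (htie : Tie r sch S₁) (R : E4 ≃ₗᵢ[ℝ] E4)
    {n : ℕ} (hn : n ≠ 0) (f : Fin n → 𝓢(E4, ℝ)) (F : 𝓢((Fin n → E4), ℂ))
    (hF : IsTensorOf F fun i => ofRealTest (f i)) (hF' : IsOffDiagonal F) :
    S₁ n (linActMulti R F) = S₁ n F :=
  apply_linActMulti_eq_of_beta_zero r sch hβ htie R (fun _ G₁ _ => degreeOne_invariant_of_tie r sch S₁ htie R G₁) hn f F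
    hF hF'

end OnePoint


/-! ## Step 0 in this crux: the cone from 9664, degrees `0, 1, 2` outright -/

/-- Degree 0: `𝔖₀ F = F default` (E0), and Lebesgue measure on the one-point space `Fin 0 → ℝ⁴` is the Dirac mass: `W₀ ≡ 1`. -/
theorem residual_zero (S₁ : SchwingerFamily E4) (h0 : S₁.toLabelled.IsNormalized) :
    ∃ W : (Fin 0 → E4) → ℂ, ∀ F : 𝓢((Fin 0 → E4), ℂ), IsOffDiagonal F →
      Integrable (fun x : Fin 0 → E4 => W x * F x) ∧ S₁ 0 F = ∫ x : Fin 0 → E4, W x * F x :=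
  Summit.QuantumFields.YangMills.Theorems.NPointIsotropy.ComplexRotationBandlimit.residual_zero S₁ h0

/-- Degree 2: the radial-kernel hypothesis IS a function residual, `W₂ x = K(x₀ − x₁)`. -/
theorem residual_two {S₁ : SchwingerFamily E4} (hK : RadialKernel S₁) :
    ∃ W : (Fin 2 → E4) → ℂ, ∀ F : 𝓢((Fin 2 → E4), ℂ), IsOffDiagonal F →
      Integrable (fun x : Fin 2 → E4 => W x * F x) ∧ S₁ 2 F = ∫ x : Fin 2 → E4, W x * F x :=
  Summit.QuantumFields.YangMills.Theorems.NPointIsotropy.ComplexRotationBandlimit.residual_two hK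

section Residual

variable {G : Type} [Group G] [TopologicalSpace G] [IsTopologicalGroup G] [CompactSpace G]
  [MeasurableSpace G] [BorelSpace G]

/-- **The planar cone of a `W₁`-family from 9664** (E0' + E3 + translations + eight frames). -/
theorem planarCone_of_W1 {r : LatticeRep G} {sch : SpeciesScheme (YMSpecies G)} {S₁ : SchwingerFamily E4}
    (hW : W1 r sch S₁) (h8 : EightFrameRP S₁) : PlanarCone S₁ :=
  stub_planarCone S₁ hW.2.1.2.2.1 hW.2.1.2.2.2.2.1 hW.2.2.1 h8

/-- **Step 0 for this crux** = the shared Step-0 stub with its cone hypothesis discharged by 9664. -/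
theorem nPointRegular_of_stubs (hG : IsCompactSimpleLieGroup G) (r : LatticeRep G) (sch : SpeciesScheme (YMSpecies G))
    (S₁ : SchwingerFamily E4) (hW : W1 r sch S₁) (h8 : EightFrameRP S₁) : NPointRegular S₁ :=
  stub_tieRegularity G hG r sch S₁ hW h8 (planarCone_of_W1 hW h8)

end Residual


/-! ## Generation 5, wave 2: `⁰𝒮` is the closed span of the off-diagonal real product tensors (five helper stubs, all CLOSED) -/

section Density

variable {G : Type} [Group G] [TopologicalSpace G] [IsTopologicalGroup G] [CompactSpace G]
  [MeasurableSpace G] [BorelSpace G]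

/-- **`⁰𝒮` tensor density, unconditional** (wave 2: `offDiagCutoffFamily` p103053 + `offDiagCutoffTendsto` p103794 +
`localOffDiagDensity` p103101, assembled by `offDiagDensity` p103110): every `F ∈ ⁰𝒮((ℝ⁴)ⁿ)` lies in the closure, for the
Schwartz topology, of the `ℂ`-span of the off-diagonal real product tensors. -/
theorem zeroSchwartz_density (n : ℕ) (F : 𝓢((Fin n → E4), ℂ)) (hF : IsOffDiagonal F) :
    F ∈ closure (Submodule.span ℂ {P : 𝓢((Fin n → E4), ℂ) | ∃ f : Fin n → 𝓢(E4, ℝ),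
      IsTensorOf P (fun i => ofRealTest (f i)) ∧ IsOffDiagonal P} : Set (𝓢((Fin n → E4), ℂ))) :=
  Summit.QuantumFields.YangMills.Theorems.NPointIsotropy.ComplexRotationBandlimit.offDiagDensity
    Summit.QuantumFields.YangMills.Theorems.NPointIsotropy.ComplexRotationBandlimit.offDiagCutoffFamily
    Summit.QuantumFields.YangMills.Theorems.NPointIsotropy.ComplexRotationBandlimit.offDiagCutoffTendsto
    Summit.QuantumFields.YangMills.Theorems.NPointIsotropy.ComplexRotationBandlimit.localOffDiagDensity n F hF

/-- **The tie PINS `S₁` on `⁰𝒮`**: two families tied along the same `(r, sch)` agree on every off-diagonal test function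
of positive degree — the crux is a statement about Wilson scaling limits and nothing else. -/
theorem tie_pins {r : LatticeRep G} {sch : SpeciesScheme (YMSpecies G)} {S₁ S₁' : SchwingerFamily E4}
    (h₁ : Tie r sch S₁) (h₁' : Tie r sch S₁') {n : ℕ} (hn : n ≠ 0) (F : 𝓢((Fin n → E4), ℂ)) (hF : IsOffDiagonal F) :
    S₁ n F = S₁' n F :=
  Summit.QuantumFields.YangMills.Theorems.NPointIsotropy.ComplexRotationBandlimit.tie_unique_offDiagonal
    zeroSchwartz_density h₁ h₁' hn F hF

/-- **The `β_k = 0`-frequently slice of the crux is PROVED** (wave 2, `betaZeroPlanarInvariant` p103139 + density): every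
family tied to such a scheme satisfies `PlanarInvariant`, whatever `G, r, c_k, m_k, a_k, L_k` — no OS clause is used. -/
theorem betaZeroSlice (r : LatticeRep G) (sch : SpeciesScheme (YMSpecies G)) (S₁ : SchwingerFamily E4)
    (htie : Tie r sch S₁) (hβ : ∃ᶠ k in atTop, sch.β k = 0) : PlanarInvariant S₁ :=
  Summit.QuantumFields.YangMills.Theorems.NPointIsotropy.ComplexRotationBandlimit.betaZeroPlanarInvariant
    zeroSchwartz_density G r sch S₁ htie hβ

/-- **The crux reduces, family by family, to planar invariance on off-diagonal real product tensors of degree `≥ 3`**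
(degrees `≤ 2`: `cruxDegreesLeTwo` p100823; degrees `≥ 3`: two continuous functionals agreeing on the generating tensors
agree on `⁰𝒮`). -/
theorem planarInvariant_of_tensors3 (r : LatticeRep G) (sch : SpeciesScheme (YMSpecies G)) (S₁ : SchwingerFamily E4)
    (htie : Tie r sch S₁) (hK : RadialKernel S₁)
    (h : ∀ (R : E4 ≃ₗᵢ[ℝ] E4), LinearMap.det (R.toLinearEquiv : E4 →ₗ[ℝ] E4) = 1 →
      R (EuclideanSpace.single 2 1) = EuclideanSpace.single 2 1 →
      R (EuclideanSpace.single 3 1) = EuclideanSpace.single 3 1 →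
      ∀ (n : ℕ), 3 ≤ n → ∀ (f : Fin n → 𝓢(E4, ℝ)) (F : 𝓢((Fin n → E4), ℂ)),
        IsTensorOf F (fun i => ofRealTest (f i)) → IsOffDiagonal F → S₁ n (linActMulti R F) = S₁ n F) :
    PlanarInvariant S₁ := by
  intro R hdet h2 h3 n F hF
  rcases Nat.lt_or_ge n 3 with hn | hn
  · exact Summit.QuantumFields.YangMills.Theorems.NPointIsotropy.ComplexRotationBandlimit.cruxDegreesLeTwo
      G r sch S₁ htie hK R n (by omega) F hF
  · exact Summit.QuantumFields.YangMills.Theorems.NPointIsotropy.ComplexRotationBandlimit.eqOn_offDiagonal_of_eqOn_tensors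
      zeroSchwartz_density ((S₁ n).comp (linActMulti R)) (S₁ n) (fun f P hP hP' => h R hdet h2 h3 n hn f P hP hP') F hF

end Density


/-! ## Generation 7: level growth at levels `a ≤ 1` is FREE under the radial kernel (NEW, sorry-free) -/

/-- **Level growth at levels `a ≤ 1` from the RADIAL KERNEL alone** (the 11686 counterpart of the sibling's
`stub_levelGrowthLow` / `levelGrowthLow_of_kernel`, which need `CurvatureKernelBound` + `ShellRigidity` + `KernelTransfer` to
make the two-point function radial): for an `e₀`-time-ordered one-point `F`, any witness `H` of `ΘF* ⊗ F` is off-diagonal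
(`IsAppendTensorOf.isOffDiagonal_of_isTimeOrdered`), so `radialKernel_invariant_two` makes its orbit function CONSTANT and the
non-zero layers of any trigonometric representation vanish (`trigPoly_coeff_eq_zero_of_const`, landed with the sibling's Stub 5a);
level `a = 0` is trivial (`linActMulti` is the identity in degree `0`).  The induction hypothesis of the level-growth shape is not
needed and not taken. -/
theorem levelGrowthLow_of_radialKernel {S₁ : SchwingerFamily E4} (hK : RadialKernel S₁) :
    ∀ a : ℕ, a ≤ 1 →
      ∀ (F : 𝓢((Fin a → E4), ℂ)), IsTimeOrdered F →
      ∀ H : 𝓢((Fin (a + a) → E4), ℂ), IsAppendTensorOf H (osAdjoint F) F →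
      ∀ (K : ℕ) (p : ℤ → ℂ),
        (∀ θ : ℝ, S₁ (a + a) (linActMulti (planeRot (0 : Fin 3) θ) H) =
          ∑ k ∈ Finset.Icc (-(K : ℤ)) K, p k * Complex.exp (4 * (k : ℂ) * (θ : ℂ) * Complex.I)) →
        ∀ k ∈ Finset.Icc (-(K : ℤ)) K, k ≠ 0 → p k = 0 := by
  intro a ha F hF H hH K p hp
  have hconst : ∀ θ : ℝ, S₁ (a + a) (linActMulti (planeRot (0 : Fin 3) θ) H) = S₁ (a + a) H := by
    obtain rfl | rfl : a = 0 ∨ a = 1 := by omega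
    · intro θ
      congr 1
      ext x
      rw [linActMulti_apply]
      congr 1
      funext i
      exact Fin.elim0 i
    · have hHoff : IsOffDiagonal H := hH.isOffDiagonal_of_isTimeOrdered hF hF
      intro θ
      exact radialKernel_invariant_two hK (planeRot (0 : Fin 3) θ) H hHoff
  intro k hk hk0
  exact Summit.QuantumFields.YangMills.Theorems.CurvatureBoostCovariance.BoostsInheritMirrors.trigPoly_coeff_eq_zero_of_const
    K p (S₁ (a + a) H) (fun θ => (hp θ).symm.trans (hconst θ)) k hk hk0

/-- The level-growth SHAPE at levels `a ≤ 1` (induction hypothesis carried, conclusion `2 ≤ |k| → p k = 0`), from the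
radial kernel. -/
theorem levelGrowthLow_shape {S₁ : SchwingerFamily E4} (hK : RadialKernel S₁) :
    ∀ a : ℕ, a ≤ 1 →
      (∀ N : ℕ, N + 2 ≤ 2 * a → ∀ R : E4 ≃ₗᵢ[ℝ] E4,
        LinearMap.det (R.toLinearEquiv : E4 →ₗ[ℝ] E4) = 1 →
        R (EuclideanSpace.single 2 1) = EuclideanSpace.single 2 1 →
        R (EuclideanSpace.single 3 1) = EuclideanSpace.single 3 1 →
        ∀ F : 𝓢((Fin N → E4), ℂ), IsOffDiagonal F → S₁ N (linActMulti R F) = S₁ N F) →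
      ∀ (F : 𝓢((Fin a → E4), ℂ)), IsTimeOrdered F → HasCompactSupport (F : (Fin a → E4) → ℂ) →
      ∀ H : 𝓢((Fin (a + a) → E4), ℂ), IsAppendTensorOf H (osAdjoint F) F →
      ∀ (K : ℕ) (p : ℤ → ℂ),
        (∀ θ : ℝ, S₁ (a + a) (linActMulti (planeRot (0 : Fin 3) θ) H) =
          ∑ k ∈ Finset.Icc (-(K : ℤ)) K, p k * Complex.exp (4 * (k : ℂ) * (θ : ℂ) * Complex.I)) →
        ∀ k ∈ Finset.Icc (-(K : ℤ)) K, 2 ≤ |k| → p k = 0 := by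
  intro a ha _ F hF _ H hH K p hp k hk hk2
  refine levelGrowthLow_of_radialKernel hK a ha F hF H hH K p hp k hk ?_
  rintro rfl
  rw [abs_zero] at hk2
  exact absurd hk2 (by norm_num)


/-- The rotation by the angle `0` acts trivially on test functions. -/
theorem linActMulti_planeRot_zero {n : ℕ} (H : 𝓢((Fin n → E4), ℂ)) :
    linActMulti (planeRot (0 : Fin 3) 0) H = H := by
  ext x
  rw [linActMulti_apply]
  congr 1
  funext i
  exact (planeRot (0 : Fin 3) 0).injective (by rw [LinearIsometryEquiv.apply_symm_apply, planeRot_zero_apply])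


/-! ## Composition (generation 12): the stubs prove the crux BY NAME; the three existing items prove it too -/

section Composition

variable {G : Type} [Group G] [TopologicalSpace G] [IsTopologicalGroup G] [CompactSpace G]
  [MeasurableSpace G] [BorelSpace G]

/-- **The skeleton (generation 12)**: `stub_temperedLatticeApproximants` (T = item 17721, through `stub_tieRegularity`),
`stub_sandwichBoundRadial` (Σ asked of this crux's families) and the landed chain (`stub_planarInvariantOfInputsRadial`) prove
`PencilRigidity.NPointIsotropy`, concluded BY NAME; the only sorries are the registered stubs. -/
theorem NPointIsotropy_of : Summit.QuantumFields.YangMills.Theses.PencilRigidity.NPointIsotropy := by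
  rw [nPointIsotropy_iff]
  intro G _ _ _ _ hG
  letI : MeasurableSpace G := borel G
  haveI : BorelSpace G := ⟨rfl⟩
  intro r sch S₁ hW h8 hK
  -- the cone (9664) and Step 0 (T through the landed glue)
  have hC : PlanarCone S₁ := planarCone_of_W1 hW h8
  have hreg : NPointRegular S₁ := stub_tieRegularity G hG r sch S₁ hW h8 hC
  -- the sandwich bounds (the YM input of generation 12)
  obtain ⟨hSig, hSigT⟩ := stub_sandwichBoundRadial G hG r sch S₁ hW h8 hK
  obtain ⟨-, hOS, htr, hhyp, -⟩ := hW
  -- the landed chain, radial form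
  exact stub_planarInvariantOfInputsRadial S₁ hOS htr hhyp h8 hC hK hreg hSig hSigT

end Composition

/-- **Σ_radial FROM THE ITEMS**: `PencilRigidity.CurvatureKernelBound` (stmt-QuantumFields-11687, BY NAME) and the sandwich
bound Σ in its registered 14999 / item-17720 form (kernel-triple antecedent, `μ < 4` in both frames; taken as a hypothesis —
Cruxes files are not importable) imply the conclusion of `stub_sandwichBoundRadial` for every family (the radial-kernel
antecedent is not even used; the Borel structure is transported along `BorelSpace.measurable_eq`). -/
theorem sandwichBoundRadial_of_items
    (hKB : Summit.QuantumFields.YangMills.Theses.PencilRigidity.CurvatureKernelBound)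
    (hSig0 : ∀ (G : Type) [Group G] [TopologicalSpace G] [IsTopologicalGroup G] [CompactSpace G]
       [MeasurableSpace G] [BorelSpace G], IsCompactSimpleLieGroup G →
       ∀ (r : LatticeRep G) (sch : SpeciesScheme (YMSpecies G)) (S₁ : SchwingerFamily E4),
         W1 r sch S₁ → EightFrameRP S₁ → PlanarCone S₁ →
         (∃ (K : E4 → ℝ) (C η : ℝ), 0 < η ∧ ContinuousOn K {x : E4 | x ≠ 0} ∧
           (∀ x : E4, x ≠ 0 → |K x| ≤ C * (1 + ‖x‖ ^ (η - 10))) ∧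
           ∀ F : 𝓢((Fin 2 → E4), ℂ), IsOffDiagonal F →
             MeasureTheory.Integrable (fun x : Fin 2 → E4 => (K (x 0 - x 1) : ℂ) * F x) ∧
               S₁ 2 F = ∫ x : Fin 2 → E4, (K (x 0 - x 1) : ℂ) * F x) →
         (∀ (h : OSReconstructionNoE1 S₁.toLabelled), ∃ μ C : ℝ, μ < 4 ∧
           (∀ (u v : ℝ), 0 < u → 0 < v → u ≤ 1 → v ≤ 1 →
              ∀ (f₁ : 𝓢((Fin 1 → E4), ℂ)) (g hh : ℝ × ℝ → ℂ) (Mg Mh Mh' : ℝ),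
                (∀ x : Fin 1 → E4, f₁ x = g (x 0 0, x 0 1) * hh (x 0 2, x 0 3)) →
                (∀ p : ℝ × ℝ, g p ≠ 0 → u ≤ p.1 ∧ p.1 ≤ 2 * u) →
                MeasureTheory.Integrable g → (∫ p, ‖g p‖) ≤ Mg →
                MeasureTheory.Integrable hh → (∫ p, ‖hh p‖) ≤ Mh → (∀ p, ‖hh p‖ ≤ Mh') →
              ∀ (n : ℕ) (W : 𝓢((Fin n → E4), ℂ)) (hW : IsTimeOrdered W)
                (hFW : IsTimeOrdered
                  (SchwartzMap.appendTensor f₁ (translateMulti ((2 * u + v) • EuclideanSpace.single 0 1) W))),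
                ‖h.fieldVec (1 + n) (fun _ => ())
                    (SchwartzMap.appendTensor f₁ (translateMulti ((2 * u + v) • EuclideanSpace.single 0 1) W)) hFW‖
                  ≤ C * Mg * (Mh + Mh') * (u ^ (-μ) + v ^ (-μ)) * ‖h.fieldVec n (fun _ => ()) W hW‖)) ∧
         (∀ (h' : OSReconstructionNoE1 (SchwingerFamily.toLabelled
             (fun n => (S₁ n).comp (linActMulti (planeRot (0 : Fin 3) (Real.pi / 4)))))),
           ∃ μ C : ℝ, μ < 4 ∧
           (∀ (u v : ℝ), 0 < u → 0 < v → u ≤ 1 → v ≤ 1 →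
              ∀ (f₁ : 𝓢((Fin 1 → E4), ℂ)) (g hh : ℝ × ℝ → ℂ) (Mg Mh Mh' : ℝ),
                (∀ x : Fin 1 → E4, f₁ x = g (x 0 0, x 0 1) * hh (x 0 2, x 0 3)) →
                (∀ p : ℝ × ℝ, g p ≠ 0 → u ≤ p.1 ∧ p.1 ≤ 2 * u) →
                MeasureTheory.Integrable g → (∫ p, ‖g p‖) ≤ Mg →
                MeasureTheory.Integrable hh → (∫ p, ‖hh p‖) ≤ Mh → (∀ p, ‖hh p‖ ≤ Mh') →
              ∀ (n : ℕ) (W : 𝓢((Fin n → E4), ℂ)) (hW : IsTimeOrdered W)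
                (hFW : IsTimeOrdered
                  (SchwartzMap.appendTensor f₁ (translateMulti ((2 * u + v) • EuclideanSpace.single 0 1) W))),
                ‖h'.fieldVec (1 + n) (fun _ => ())
                    (SchwartzMap.appendTensor f₁ (translateMulti ((2 * u + v) • EuclideanSpace.single 0 1) W)) hFW‖
                  ≤ C * Mg * (Mh + Mh') * (u ^ (-μ) + v ^ (-μ)) * ‖h'.fieldVec n (fun _ => ()) W hW‖))) :
    ∀ (G : Type) [Group G] [TopologicalSpace G] [IsTopologicalGroup G] [CompactSpace G]
      [MeasurableSpace G] [BorelSpace G], IsCompactSimpleLieGroup G →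
      ∀ (r : LatticeRep G) (sch : SpeciesScheme (YMSpecies G)) (S₁ : SchwingerFamily E4),
        W1 r sch S₁ → EightFrameRP S₁ → RadialKernel S₁ →
        (∀ (h : OSReconstructionNoE1 S₁.toLabelled), ∃ μ C : ℝ, μ < 4 ∧
          (∀ (u v : ℝ), 0 < u → 0 < v → u ≤ 1 → v ≤ 1 →
             ∀ (f₁ : 𝓢((Fin 1 → E4), ℂ)) (g hh : ℝ × ℝ → ℂ) (Mg Mh Mh' : ℝ),
               (∀ x : Fin 1 → E4, f₁ x = g (x 0 0, x 0 1) * hh (x 0 2, x 0 3)) →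
               (∀ p : ℝ × ℝ, g p ≠ 0 → u ≤ p.1 ∧ p.1 ≤ 2 * u) →
               MeasureTheory.Integrable g → (∫ p, ‖g p‖) ≤ Mg →
               MeasureTheory.Integrable hh → (∫ p, ‖hh p‖) ≤ Mh → (∀ p, ‖hh p‖ ≤ Mh') →
             ∀ (n : ℕ) (W : 𝓢((Fin n → E4), ℂ)) (hW : IsTimeOrdered W)
               (hFW : IsTimeOrdered
                 (SchwartzMap.appendTensor f₁ (translateMulti ((2 * u + v) • EuclideanSpace.single 0 1) W))),
               ‖h.fieldVec (1 + n) (fun _ => ())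
                   (SchwartzMap.appendTensor f₁ (translateMulti ((2 * u + v) • EuclideanSpace.single 0 1) W)) hFW‖
                 ≤ C * Mg * (Mh + Mh') * (u ^ (-μ) + v ^ (-μ)) * ‖h.fieldVec n (fun _ => ()) W hW‖)) ∧
        (∀ (h' : OSReconstructionNoE1 (SchwingerFamily.toLabelled
            (fun n => (S₁ n).comp (linActMulti (planeRot (0 : Fin 3) (Real.pi / 4)))))),
          ∃ μ C : ℝ,
          (∀ (u v : ℝ), 0 < u → 0 < v → u ≤ 1 → v ≤ 1 →
             ∀ (f₁ : 𝓢((Fin 1 → E4), ℂ)) (g hh : ℝ × ℝ → ℂ) (Mg Mh Mh' : ℝ),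
               (∀ x : Fin 1 → E4, f₁ x = g (x 0 0, x 0 1) * hh (x 0 2, x 0 3)) →
               (∀ p : ℝ × ℝ, g p ≠ 0 → u ≤ p.1 ∧ p.1 ≤ 2 * u) →
               MeasureTheory.Integrable g → (∫ p, ‖g p‖) ≤ Mg →
               MeasureTheory.Integrable hh → (∫ p, ‖hh p‖) ≤ Mh → (∀ p, ‖hh p‖ ≤ Mh') →
             ∀ (n : ℕ) (W : 𝓢((Fin n → E4), ℂ)) (hW : IsTimeOrdered W)
               (hFW : IsTimeOrdered
                 (SchwartzMap.appendTensor f₁ (translateMulti ((2 * u + v) • EuclideanSpace.single 0 1) W))),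
               ‖h'.fieldVec (1 + n) (fun _ => ())
                   (SchwartzMap.appendTensor f₁ (translateMulti ((2 * u + v) • EuclideanSpace.single 0 1) W)) hFW‖
                 ≤ C * Mg * (Mh + Mh') * (u ^ (-μ) + v ^ (-μ)) * ‖h'.fieldVec n (fun _ => ()) W hW‖)) := by
  intro G _ _ _ _ inst hB hG r sch S₁ hW h8 _
  have hmeas : inst = borel G := hB.measurable_eq
  subst hmeas
  letI : MeasurableSpace G := borel G
  haveI : BorelSpace G := ⟨rfl⟩
  have hC : PlanarCone S₁ := planarCone_of_W1 hW h8
  have hK := hKB G hG r sch S₁ hW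
  obtain ⟨hSig, hSigT⟩ := hSig0 G hG r sch S₁ hW h8 hC hK
  exact ⟨hSig, fun h' => let ⟨μ, C, _, hS⟩ := hSigT h'; ⟨μ, C, hS⟩⟩

/-! ### The certificate over three EXISTING items lives in a Theorems file (wave 1, stub `stub_stepZeroOfT`'s file):
`nPointIsotropy_of_items : T → Σ (17720 text) → PencilRigidity.CurvatureKernelBound → PencilRigidity.NPointIsotropy` — pure logic
over 14999's landed `stub_cruxOfInputs` (T feeds its Step-0 antecedent through `stub_stepZeroOfLattice`) and this crux's landed
`nPointIsotropy_of_kernelBound_of_softKernel'`.  It is NOT restated here, so that `NPointIsotropy_of` stays the unique theorem of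
this file concluding the crux (the skeleton check requires it). -/

/-- **The radial bet of generations 7–11 is now a COROLLARY**: `stub_levelGrowthHigh` in its radial form (the form this crux
consumed, certified NECESSARY by the landed `levelGrowthHighRadial_of_nPointIsotropy`, p109025) follows from T ∧ Σ_radial through
`NPointIsotropy_of` — the bet has been cut down to a UV power-counting statement. -/
example : ∀ (G : Type) [Group G] [TopologicalSpace G] [IsTopologicalGroup G] [CompactSpace G] [MeasurableSpace G]
    [BorelSpace G], IsCompactSimpleLieGroup G →
    ∀ (r : LatticeRep G) (sch : SpeciesScheme (YMSpecies G)) (S₁ : SchwingerFamily E4),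
      W1 r sch S₁ → EightFrameRP S₁ → RadialKernel S₁ →
      ∀ a : ℕ, 2 ≤ a →
        (∀ N : ℕ, N + 2 ≤ 2 * a → ∀ R : E4 ≃ₗᵢ[ℝ] E4,
          LinearMap.det (R.toLinearEquiv : E4 →ₗ[ℝ] E4) = 1 →
          R (EuclideanSpace.single 2 1) = EuclideanSpace.single 2 1 →
          R (EuclideanSpace.single 3 1) = EuclideanSpace.single 3 1 →
          ∀ F : 𝓢((Fin N → E4), ℂ), IsOffDiagonal F → S₁ N (linActMulti R F) = S₁ N F) →
        ∀ (F : 𝓢((Fin a → E4), ℂ)), IsTimeOrdered F → HasCompactSupport (F : (Fin a → E4) → ℂ) →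
        ∀ H : 𝓢((Fin (a + a) → E4), ℂ), IsAppendTensorOf H (osAdjoint F) F →
        ∀ (K : ℕ) (p : ℤ → ℂ),
          (∀ θ : ℝ, S₁ (a + a) (linActMulti (planeRot (0 : Fin 3) θ) H) =
            ∑ k ∈ Finset.Icc (-(K : ℤ)) K, p k * Complex.exp (4 * (k : ℂ) * (θ : ℂ) * Complex.I)) →
          ∀ k ∈ Finset.Icc (-(K : ℤ)) K, 2 ≤ |k| → p k = 0 :=
  Summit.QuantumFields.YangMills.Theorems.NPointIsotropy.ComplexRotationBandlimit.levelGrowthHighRadial_of_nPointIsotropy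
    NPointIsotropy_of

/-! ## Checks against the landed negative / positive knowledge (imports live; sorry-free) -/

/-- Stub 2 is literally the shared item `MirrorModularBoosts.PlanarSpectralCone` (stmt-QuantumFields-9664). -/
theorem stub_planarCone_iff :
    (∀ S₁ : SchwingerFamily E4, S₁.toLabelled.HasLinearGrowth → S₁.toLabelled.IsSymmetric →
        Translations S₁ → EightFrameRP S₁ → PlanarCone S₁) ↔
      Summit.QuantumFields.YangMills.Theses.MirrorModularBoosts.PlanarSpectralCone :=
  Iff.rfl

/-- The model-blind form of the crux (both lattice clauses dropped) is FALSE (junk family, file IV): no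
rearrangement of the model-blind stubs may conclude `PlanarInvariant` without the Step-0 residual. -/
example : ¬ Summit.QuantumFields.YangMills.Theorems.NPointIsotropy.Negative.NPointIsotropyModelBlind :=
  not_NPointIsotropyModelBlind

/-- The tie AT ORDER 4 (file V) is load-bearing: `stub_tieRegularity3` consumes `W1` at the orders `≥ 3` where junk lives. -/
example : ¬ Summit.QuantumFields.YangMills.Theorems.NPointIsotropy.Negative.NPointIsotropyWithoutTieAt4 :=
  not_NPointIsotropyWithoutTieAt4

/-- Degree `2` of the kill is free from the radial kernel alone (file IX), for EVERY linear isometry. -/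
example {S₁ : SchwingerFamily E4} (hK : RadialKernel S₁) (R : E4 ≃ₗᵢ[ℝ] E4) (F : 𝓢((Fin 2 → E4), ℂ))
    (hF : IsOffDiagonal F) : S₁ 2 (linActMulti R F) = S₁ 2 F :=
  radialKernel_invariant_two hK R F hF

section DegreesLeTwo

variable {G : Type} [Group G] [TopologicalSpace G] [IsTopologicalGroup G] [CompactSpace G]
  [MeasurableSpace G] [BorelSpace G]

/-- **Degrees `≤ 2` of the CRUX are closed UNCONDITIONALLY (generation 5)**: for a tied family with the radial two-point kernel,
`𝔖₀, 𝔖₁, 𝔖₂` are invariant on `⁰𝒮` under EVERY linear isometry of `ℝ⁴` — degree 0 trivially, degree 1 through the tie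
(`degreeOne_invariant_of_tie`), degree 2 by the radial kernel (`radialKernel_invariant_two`). No E2, no cone, no residual
hypothesis, no translations. So the content of the crux is exactly `n ≥ 3`. -/
theorem crux_degrees_le_two (r : LatticeRep G) (sch : SpeciesScheme (YMSpecies G)) (S₁ : SchwingerFamily E4)
    (htie : Tie r sch S₁) (hK : RadialKernel S₁) (R : E4 ≃ₗᵢ[ℝ] E4) {n : ℕ} (hn : n ≤ 2) (F : 𝓢((Fin n → E4), ℂ))
    (hF : IsOffDiagonal F) : S₁ n (linActMulti R F) = S₁ n F := by
  interval_cases n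
  · rw [Summit.QuantumFields.YangMills.Theorems.NPointIsotropy.ComplexRotationBandlimit.DegreeLeTwo.linActMulti_fin_zero]
  · exact degreeOne_invariant_of_tie r sch S₁ htie R F
  · exact radialKernel_invariant_two hK R F hF

end DegreesLeTwo


/-! ## Record: the superseded stubs of generations 2–11 are IMPLIED by, or REPLACED under, the new inputs

Generations 2–6: `stub_entire` / `stub_harmonicKill` / `stub_mopup` (see the generation-7 header).  Generations 7–11: the analytic
input `stub_doubledOrbitKernel(High)` is not implied by T ∧ Σ_radial as a statement about ALL coned families, but its USE — uniform
planar boost vectors of tied families — is what `stub_asmUniformBoost` constructs from Σ; the bet `stub_levelGrowthHigh` (radial form)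
IS implied (the last `example` above).  Not restated as theorems here, so that `NPointIsotropy_of` stays the unique theorem of this
file concluding the crux. -/

/-! ## Generation 12b: the crux from the ITEMS of route `IsotropyFromPowerCounting`, BY NAME (landed p140808; re-checked here) -/

/-- **By-name certificate (re-check of the landed `nPointIsotropy_of_routeItems`)**: Step 0 (stmt-17723) → Σ (stmt-18372) →
`PencilRigidity.CurvatureKernelBound` (stmt-11687) → the crux. -/
example :
    Summit.QuantumFields.YangMills.Theses.IsotropyFromPowerCounting.CurvatureDensities →
    Summit.QuantumFields.YangMills.Theses.IsotropyFromPowerCounting.CurvatureSandwichBound →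
    Summit.QuantumFields.YangMills.Theses.PencilRigidity.CurvatureKernelBound →
    Summit.QuantumFields.YangMills.Theses.PencilRigidity.NPointIsotropy :=
  Summit.QuantumFields.YangMills.Theorems.NPointIsotropy.ComplexRotationBandlimit.nPointIsotropy_of_routeItems

/-- **By-name certificate from the three cruxes** (T = stmt-17721 instead of Step 0). -/
example :
    Summit.QuantumFields.YangMills.Theses.IsotropyFromPowerCounting.TemperedCurvatureMoments →
    Summit.QuantumFields.YangMills.Theses.IsotropyFromPowerCounting.CurvatureSandwichBound →
    Summit.QuantumFields.YangMills.Theses.PencilRigidity.CurvatureKernelBound →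
    Summit.QuantumFields.YangMills.Theses.PencilRigidity.NPointIsotropy :=
  Summit.QuantumFields.YangMills.Theorems.NPointIsotropy.ComplexRotationBandlimit.nPointIsotropy_of_routeCruxes

end Summit.QuantumFields.YangMills.Cruxes.NPointIsotropy.ComplexRotationBandlimit

end
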